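import Mathlib
import Literature.NumberTheory.LFunctions.Zhang2022.SkeletonPartThree
import Literature.NumberTheory.LFunctions.Zhang2022.TypedSection15A
import Literature.NumberTheory.LFunctions.Zhang2022.Section14MeanSquareMajorant
import Literature.NumberTheory.LFunctions.Zhang2022.Section4GaussianWeight
import HarnessLib

/-!
# Zhang (2022), typed manuscript — §15 part B: (15.12)–(15.21) and the proof-intermediate
# displays between them (tex L4162–4266, PDF pp. 83–86), STATED NOT ASSERTED

Topic `Literature/NumberTheory/LFunctions/Zhang2022` (Landau–Siegel audit tree; verdict-neutral).
Y. Zhang, *Discrete mean estimates and the Landau–Siegel zero*, arXiv:2211.02515v1 (2022)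
[Zhang2022LandauSiegel] — **an unrefereed manuscript under adjudication. Every `def … : Prop` below is
a CLAIM OF THE MANUSCRIPT, transcribed as printed with its page/tex locator and campaign DAG node id;
nothing here asserts or denies Theorems 1–2; the only theorems are the kernel proofs of the slice's pure
identities (section `Edges`), of the local estimate §15.u031 (section `StepU031`), of the Mellin
identity §15.u029 (section `StepU029`) and of the edges u036 ⇐ (15.14)+u034, (15.21) ⇐ u040
(sections `StepU036`, `Eq1521`), of (15.20) ⇐ multiplicativity of `ϖ_{1j}` (section `Eq1520`) and of
`ℳ₁(1,1;s) ≠ 0`, (15.19), the multiplicativity of `ϖ_{1j}`, (15.20) ⇐ (15.18) (section `Eq1518`), and of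
the inline claim "`ξ₁(n;d,l)` is multiplicative in `n`" (section `Xi1Mult`).** Objects introduced by the manuscript with "with / where /
Let … =" are real definitions over the banked skeleton (`…Zhang2022.Skeleton`, files `Skeleton*.lean`),
the §15 part A objects of `TypedSection15A` (`…Typed.Section15A`: `kappa1` = the tree's
`MeanSquareMajorant.kappa₁`, `kappaTilde1`, `lam1`, `gtilde3`, `calD1`, `calR1star`, `Phi1p`/`Phi1pOf`,
`CoefFam`/`bLit`/`bChi`) and the tree's `GaussWeight.omega1` (`ω₁`, (4.1)).

This slice continues the evaluation of `Φ₁` (§15, "Evaluation of `Φ₁`") from the point where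
`𝒟₁(d,l)` has been introduced ((15.11) and the display after it, slice 15A) up to the statement of
Lemma 15.1 (slice 15C; the lemma itself is the banked node `Skeleton.Lemma151`). TeX macros of the
source: `\d = 𝒟`, `\m = ℳ`, `\s = 𝒮`, `\r = ℛ`, `\q = 𝒬`, `\n = 𝒩` (all `\mathcal`).

## Node table (DAG ids `Z22:…` of `plan/DAG.tsv`; all refine the coarse deduction node
`Skeleton.Ded1524 c′` = "§15 ⇒ (15.24)")

| DAG node | locator | decl | kind |
|---|---|---|---|
| `Z22:(15.12)` | p.83, tex L4162 | `Eq15_12` | claim (identity) — PROVED `eq15_12_holds` |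
| `Z22:(15.13)` | p.83, tex L4166 | `xi1` | object `ξ₁(n;d,l)` |
| — (inline) | p.83, tex L4168 | `Inline15_xi1Mult` | claim "`ξ₁(n;d,l)` is multiplicative in `n`" — PROVED `inline15_xi1Mult_holds` |
| `Z22:§15.u026` | p.83, tex L4170 | `Step15_u026` | claim (identity) — PROVED `step15_u026_holds` |
| `Z22:§15.u027` | p.83, tex L4174 | `lamTilde1` | object `λ̃₁(n,d)` |
| `Z22:§15.u028` | p.84, tex L4178 | `Step15_u028` | claim (identity) — PROVED `step15_u028_holds` |
| `Z22:§15.u029` | p.84, tex L4182 | `Step15_u029` | claim (Mellin identity) — PROVED `step15_u029_holds` |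
| `Z22:(15.14)` | p.84, tex L4186 | `Eq15_14` | claim `O(ε)` |
| — (inline) | p.84, tex L4189 | `Inline15_lamTildePow` | claim `λ̃₁(qʳ,d) = λ̃₁(q,d)` — PROVED |
| `Z22:§15.u030` | p.84, tex L4191 | `Step15_u030` | claim (Euler product, `σ > 1`) |
| `Z22:§15.u031` | p.84, tex L4195 | `Step15_u031` | claim — PROVED `step15_u031_holds` |
| `Z22:§15.u032` | p.84, tex L4199 | `Step15_u032` | claim `1 + O(q^{−19/10})` |
| `Z22:§15.u033` | p.84, tex L4203 | `Step15_u033` | claim `1 + O(q^{−9/10})` |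
| `Z22:§15.u034` | p.84, tex L4205 | `calM1Series`, `calM1Factor`, `calM1`; `Step15_u034`, `Step15_u034an` | object `ℳ₁(d,l;s)` + "is analytic" |
| `Z22:§15.u035` | p.84, tex L4209 | `Step15_u035` | claim `ℳ₁ ≪ ∏(1 + cq^{−9/10})` |
| `Z22:§15.u036` | p.85, tex L4213 | `Step15_u036` | claim (rewriting of (15.14)) — EDGE `step15_u036_of_eq15_14` (⇐ (15.14) + u034) |
| — (inline) | p.85, tex L4217 | `Inline15_P4d` | claim "Note that `P₄/d > T`" (FLAGGED, see decl) |
| `Z22:(15.15)` | p.85, tex L4218 | `Eq15_15` | claim `O(ε₁)` |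
| `Z22:(15.16)` | p.85, tex L4222 | `F1516`, `calR1` | object: the function (15.16) and its residues `ℛ_{1j}` |
| `Z22:(15.17)` | p.85, tex L4226 | `Eq15_17` | claim `o(p)` |
| `Z22:§15.u037` | p.85, tex L4230 | `calS1` | object `𝒮_{1j}` |
| — (inline) | p.85, tex L4232 | `Inline15_localEq` | claim (local data at `q ∤ dl`) — PROVED |
| `Z22:(15.18)` | p.85, tex L4235 | `Eq15_18` | claim (identity) |
| `Z22:(15.19)` | p.85, tex L4240 | `Eq15_19` | claim (identity) — EDGES `eq15_19_of_ne_zero`, `eq15_19_of_eq15_18` (⇐ (15.18)) |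
| `Z22:§15.u038` | p.85, tex L4244 | `varpi1` | object `ϖ_{1j}(n)` |
| — (inline) | p.85, tex L4246 | `Inline15_varpiMult` | claim "`ϖ_{1j}` is multiplicative" — EDGE `inline15_varpiMult_of_eq15_18` (⇐ (15.18)) |
| `Z22:§15.u039` | p.85, tex L4250 | = cited `Skeleton.frakq` | object `𝒬 = ∏_{q<D⁴} q` (banked) |
| `Z22:(15.20)` | p.86, tex L4254 | `Eq15_20` | claim (identity) — EDGES `eq15_20_lit_of_varpiMult`/`eq15_20_chi_of_varpiMult` (⇐ `Inline15_varpiMult`), `eq15_20_lit_of_eq15_18` (⇐ (15.18)) |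
| — (inline) | p.86, tex L4257 | `Inline15_Rankin` | claim "impose `n₁ < T` with error `O(ε₁)`" |
| `Z22:§15.u040` | p.86, tex L4258 | `Step15_u040` | claim `1 + O(D^{−c})` |
| `Z22:(15.21)` | p.86, tex L4262 | `Eq15_21` | claim `O(τ₂(n)D^{−c})` — EDGE `eq15_21_of_step15_u040` (⇐ u040) |
| `Z22:§15.u041` | p.86, tex L4266 | = cited `Skeleton.varrhoStar` | object `ϱ*_j(n)` (banked) |

## Conventions (those of the skeleton, `SkeletonPropositions` §Conventions, not re-encoded)

* "for `D` large" = `Skeleton.ForAllLarge`; Assumption (A) = `Skeleton.AssumptionA D χ` as an antecedent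
  inside it (standing assumption of §§5–18); "`X = Y + O(E)`" ↦ `∃ C, … ‖X − Y‖ ≤ C·E`; "`o(p)`" ↦
  `∀ ε > 0, … ≤ ε·p`; `ε = exp{−c𝓛¹⁰}` (§4 p. 19, tex L1062) and `ε₁ = exp{−c𝓛^{1/10}}` (§7, tex L2128)
  with an unspecified `c > 0` ↦ `∃ c > 0, ∃ C, … ≤ C·exp(−c𝓛¹⁰)` resp. `… ≤ C·exp(−c𝓛^{1/10})`;
  "`D^{−c}`" likewise `∃ c > 0`. `β_j` = `Skeleton.betaJ c' D j` (`j ∈ {1,2,3}`); `c′` = the constant of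
  (2.13), a parameter of every decl touching `β₁, β₂, β₃`.
* `(1/2πi)∫_{(1)} F(s) ds` (the full vertical line `Re s = 1`) is written inline in the tree's house
  style `(1/(2π))∫_ℝ F(1+it) dt` (`s = 1 + it`, `ds = i dt`; cf. `GaussWeight.gWeight_eq_verticalIntegral`);
  the two long integrands of (15.14) and u036 are the named objects `integrand1514`, `integrandU036`.
* Sums "`Σ_n b(n)…`" run over `1 ≤ n < ⌈P⌉` exactly as in the banked `Skeleton.Lemma151` (the
  coefficients `b(n)` = `Skeleton.bcoef D n` vanish for `n > PT⁻²η₊`, (15.2)); sums weighted by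
  `g̃₃(dn) = (dn)^{β₃}g*(P₄/(dn))` run over `1 ≤ n ≤ ⌊2P₄⌋` (`g*(y) = 0` for `y ≤ 1/2`), as in the banked
  `Skeleton.main141`; `τ₂(n)` = `n.divisors.card`; `φ` = `Nat.totient`; `μ` = `ArithmeticFunction.moebius`.
* **`ℳ₁(d,l;s)`** (u034). The printed defining expression
  `ζ(s)L(s,χ)ζ(s+β₁)⁻¹ζ(s+β₂)⁻¹ Σ_n λ̃₁(n,d)ξ₁(n;d,l)n^{−s}` is `calM1Series` (a Dirichlet series,
  absolutely convergent for `σ > 1` only; at the points of use `s = 1 − β_j` the series `Σ_n` has a pole).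
  The manuscript immediately continues it ("so that … = 1 + O(q^{−19/10}) for σ > 9/10 … It follows that
  the function ℳ₁(d,l;s) is analytic") through the Euler product of u030/u032; `calM1` IS that Euler
  product `∏'_q calM1Factor` (a `tprod` over `Nat.Primes`, junk value `1` where not multipliable), so
  that `ℳ₁(d,l;1−β_j)` in (15.15)–(15.21) denotes a definite number, and u034 is typed as the identity
  `calM1 = calM1Series` on `σ > 1` (`Step15_u034`) plus the analyticity claim (`Step15_u034an`).
* **`ℛ_{1j}`** ((15.16)) = "the residue of the function (15.16) at `s = −β_j`", typed for a simple pole as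
  `lim_{s → −β_j} (s + β_j)·F(s)` (`limUnder` on the punctured neighbourhood; junk if the limit fails).
* **§15 part A objects** (`κ₁` p. 81, `κ̃₁(d;r,s)` (15.9), `λ₁(n,s)` (15.10), `g̃₃` p. 81, `𝒟₁(d,l)`
  p. 83, `ℛ₁*` p. 83, `Φ₁(p)` (15.7)) are IMPORTED from `TypedSection15A` (seat L4-t1; L4 NAMING v1:
  `kappa1`, `kappaTilde1`, `lam1`, `gtilde3`, `calD1`, `calR1star`, `Phi1p := Phi1pOf … (Skeleton.bcoef D)`),
  never re-declared (rev. 2: the interim stubs of rev. 1 — same names, same bodies — are gone).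
* **The coefficients `b`.** (15.1) prints `B(s,ψ) = Σ_n b(n)χψ(n)n^{−s}` (`b` = `Skeleton.bcoef`, χ-free),
  while from p. 81 on the manuscript uses `b` as the `ψ`-coefficient of `B` (campaign gap row G-L4t1-1,
  "χ-twist of `b`"; discharge-lane ruling: read `b ↦ χ·b`). Following `TypedSection15A`, every
  `b`-dependent decl here (`calS1`, (15.17), (15.19), (15.20), the Rankin remark) takes a coefficient
  family `b : CoefFam` (or sequence `b : ℕ → ℂ`); the PRINTED node is the instance `bLit`
  (`bLit D χ = Skeleton.bcoef D`), the χ-absorbed reading is `bChi` (`bChi D χ n = χ(n)·bcoef D n`).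

What is NOT here: (15.1)–(15.11) (`TypedSection15A`), Lemma 15.1 and (15.22)–(15.24), Lemmas 15.2–15.3
(`TypedSection15C`; `Skeleton.Lemma151`, `Skeleton.Eval1524`), Appendix A's formulas (A.4)–(A.7) for
`ℳ₁` (`TypedAppendixA1/A2`), any analytic proof. PROVED here (sections `Edges`, `StepU031`, `StepU029`,
`StepU036`, `Eq1521`; kernel, 0 facts): `step15_u026_holds`, `eq15_12_holds`, `step15_u028_holds`,
`inline15_lamTildePow_holds`, `inline15_localEq_holds`, `step15_u031_holds` (with `xi1_prime_eq`,
`kappaTilde1_prime_eq_tsum`), `step15_u029_holds` (via the tree's `GaussWeight.gWeight_eq_verticalIntegral`),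
and the conditional edges `eq15_19_of_ne_zero`, `step15_u036_of_eq15_14` (u036 ⇐ (15.14) + u034),
`eq15_21_of_step15_u040` ((15.21) ⇐ u040, using that `χ` is real and `(n,𝒬) = 1 ⇒ (n,D) = 1`),
`eq15_20_of_varpiMult` ((15.20) ⇐ `ϖ_{1j}` multiplicative, for any coefficient family vanishing from `P`
on: `eq15_20_lit_of_varpiMult`, `eq15_20_chi_of_varpiMult`, via the factorisation `n = n₁n₂`,
`exists_smooth_mul_rough`/`smooth_mul_rough_unique`, and `Section15A.eq15_2_holds`), and from (15.18):
`calM1_one_one_ne_zero_of_eq15_18`, `eq15_19_of_eq15_18`, `inline15_varpiMult_of_eq15_18` (the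
manuscript's "in view of (15.18)": the local factors depend on `(d,l)` only through `q ∣ d`, `q ∣ l`),
`eq15_20_lit_of_eq15_18`/`eq15_20_chi_of_eq15_18`; and `inline15_xi1Mult_holds` (p. 83: `ξ₁(·;d,l)` is
multiplicative — absolute convergence of `κ̃₁` (`summable_norm_kappaTilde1_term`, `|κ₁(n)| ≤ τ₂(n)²`,
Mathlib's Euler product over factored numbers), `κ̃₁(m₁m₂;r) = κ̃₁(m₁;r)κ̃₁(m₂;r)`
(`kappaTilde1_mul_of_coprime`), locality `kappaTilde1_mul_right_eq`, divisor-pair bijection).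

## References

* Y. Zhang, arXiv:2211.02515v1 (2022), §15 pp. 83–86, (15.12)–(15.21).
  [cite: Zhang2022LandauSiegel, §15 (15.12)–(15.21)]
-/

noncomputable section

open Complex Real ComplexConjugate Filter MeasureTheory
open scoped Topology

namespace Literature.NumberTheory.LFunctions.Zhang2022.Typed.Section15B

-- the §15 part A objects (seat L4-t1's `TypedSection15A`, L4 NAMING v1) and its coefficient families
open Literature.NumberTheory.LFunctions.Zhang2022.Typed.Section15A
  (CoefFam bLit bChi bchi kappa1 kappaTilde1 lam1 gtilde3 calD1 calR1star Phi1p Phi1pOf)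


/-! ## §15 part B objects: `ξ₁`, `λ̃₁`, `ℳ₁`, the function (15.16) and `ℛ_{1j}`, `𝒮_{1j}`, `ϖ_{1j}`
(the part-A objects `κ̃₁`, `λ₁`, `g̃₃`, `𝒟₁`, `ℛ₁*`, `Φ₁(p)` are `Section15A.kappaTilde1/lam1/gtilde3/calD1/
calR1star/Phi1p`, opened above) -/

section Objects

variable (c' : ℝ) {D : ℕ} (χ : DirichletCharacter ℂ D)

/-- **`ξ₁(n;d,l) = Σ_{n=mk,(k,l)=1} μχ(k)k/φ(k) · κ̃₁(m;dk)`** (15.13) (§15 p. 83, tex L4166;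
`κ̃₁(m;dk) = κ̃₁(m;dk,1)` = `Section15A.kappaTilde1 … 1`). DAG `Z22:(15.13)`. [cite: Zhang2022LandauSiegel, §15 (15.13) p. 83] -/
def xi1 (n d l : ℕ) : ℂ :=
  ∑ k ∈ n.divisors.filter (fun k => Nat.Coprime k l),
    (ArithmeticFunction.moebius k : ℂ) * χ (k : ZMod D) * (k : ℂ) / (Nat.totient k : ℂ) *
      kappaTilde1 c' χ (n / k) (d * k) 1

/-- **`λ̃₁(n,d) = ∏_{q∣n,(q,d)=1} λ₁(q)`** (§15 p. 83, tex L4174; `λ₁(q) = λ₁(q,1)` = `Section15A.lam1 … q 1`). DAG `Z22:§15.u027`.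
[cite: Zhang2022LandauSiegel, §15 p. 83] -/
def lamTilde1 (n d : ℕ) : ℂ :=
  ∏ q ∈ n.primeFactors.filter (fun q => Nat.Coprime q d), lam1 c' χ q 1

/-- The local series `Σ_{r≥1} ξ₁(qʳ;d,l)q^{−rs}` appearing in the Euler factors of p. 84
(tex L4191, L4199) and in (15.18). [cite: Zhang2022LandauSiegel, §15 p. 84] -/
def xi1LocalSeries (q d l : ℕ) (s : ℂ) : ℂ :=
  ∑' r : ℕ, if r = 0 then 0 else xi1 c' χ (q ^ r) d l / (q : ℂ) ^ ((r : ℂ) * s)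

/-- The PRINTED defining expression of **`ℳ₁(d,l;s)`** (§15 p. 84, tex L4205):
`ζ(s)L(s,χ)/(ζ(s+β₁)ζ(s+β₂)) · Σ_n λ̃₁(n,d)ξ₁(n;d,l)n^{−s}` (the `n`-sum a Dirichlet series, absolutely
convergent for `σ > 1`; `tsum`, junk `0` if divergent). DAG `Z22:§15.u034` (see `calM1`).
[cite: Zhang2022LandauSiegel, §15 p. 84] -/
def calM1Series [NeZero D] (d l : ℕ) (s : ℂ) : ℂ :=
  riemannZeta s * χ.LFunction s / (riemannZeta (s + Skeleton.beta1 c' D) *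
      riemannZeta (s + Skeleton.beta2 c' D)) *
    ∑' n : ℕ, lamTilde1 c' χ n d * xi1 c' χ n d l / (n : ℂ) ^ s

/-- The Euler factor of `ℳ₁(d,l;s)` at the prime `q` (§15 p. 84, the left side of the display at
tex L4199): `(1−q^{−s−β₁})(1−q^{−s−β₂})(1−q^{−s})⁻¹(1−χ(q)q^{−s})⁻¹(1 + λ̃₁(q,d)Σ_r ξ₁(qʳ;d,l)q^{−rs})`.
[cite: Zhang2022LandauSiegel, §15 p. 84] -/
def calM1Factor (q d l : ℕ) (s : ℂ) : ℂ :=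
  (1 - (q : ℂ) ^ (-(s + Skeleton.beta1 c' D))) * (1 - (q : ℂ) ^ (-(s + Skeleton.beta2 c' D))) /
      ((1 - (q : ℂ) ^ (-s)) * (1 - χ (q : ZMod D) * (q : ℂ) ^ (-s))) *
    (1 + lamTilde1 c' χ q d * xi1LocalSeries c' χ q d l s)

/-- **`ℳ₁(d,l;s)`** (§15 p. 84, tex L4205: "It follows that the function `ℳ₁(d,l;s) := …` is analytic
and it satisfies `ℳ₁(d,l;s) ≪ ∏_{q∣dl}(1 + cq^{−9/10})` for `σ > 9/10`"), DEFINED as the Euler product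
`∏'_q calM1Factor q d l s` over the primes — the manuscript's analytic continuation (via u030/u032) of
the printed Dirichlet-series expression `calM1Series` from `σ > 1` to `σ > 9/10`, so that
`ℳ₁(d,l;1−β_j)` ((15.15) ff.) is a definite number; `tprod`, junk value `1` if not multipliable.
The identity with the printed expression on `σ > 1` is the claim `Step15_u034`. DAG `Z22:§15.u034`.
[cite: Zhang2022LandauSiegel, §15 p. 84] -/
def calM1 (d l : ℕ) (s : ℂ) : ℂ := ∏' q : Nat.Primes, calM1Factor c' χ (q : ℕ) d l s

/-- **The function (15.16)** (§15 p. 85, tex L4222):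
`ζ(1+s+β₁)ζ(1+s+β₂)ζ(1+s)⁻¹L(1+s,χ)⁻¹ · P₄^{s+β₃}ω₁(s+β₃)/(s+β₃)` (`ω₁(w) = exp{w²/(4𝓛³⁰)}`, (4.1) =
`GaussWeight.omega1 (𝓛³⁰)`). DAG `Z22:(15.16)`. [cite: Zhang2022LandauSiegel, §15 (15.16) p. 85] -/
def F1516 [NeZero D] (s : ℂ) : ℂ :=
  riemannZeta (1 + s + Skeleton.beta1 c' D) * riemannZeta (1 + s + Skeleton.beta2 c' D) /
      (riemannZeta (1 + s) * χ.LFunction (1 + s)) *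
    ((Skeleton.P4 D : ℂ) ^ (s + Skeleton.beta3 c' D) *
      GaussWeight.omega1 (Skeleton.ell D ^ 30) (s + Skeleton.beta3 c' D) / (s + Skeleton.beta3 c' D))

/-- **`ℛ_{1j}`, `1 ≤ j ≤ 3`: "the residue of the function (15.16) at `s = −β_j`"** (§15 p. 85, tex
L4221–4224; the poles at `−β₁, −β₂` come from `ζ(1+s+β₁)ζ(1+s+β₂)`, the pole at `−β₃` from `1/(s+β₃)`),
typed for a simple pole as `lim_{s→−β_j, s≠−β_j} (s+β_j)·(15.16)(s)`. DAG `Z22:(15.16)`.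
[cite: Zhang2022LandauSiegel, §15 (15.16) p. 85] -/
def calR1 [NeZero D] (j : ℕ) : ℂ :=
  limUnder (𝓝[≠] (-Skeleton.betaJ c' D j))
    (fun s => (s + Skeleton.betaJ c' D j) * F1516 c' χ s)

/-- **`𝒮_{1j} = Σ_n b(n)n⁻¹ Σ_{n=dl} λ₁(d)d^{β_j}χ(l)ℳ₁(d,l;1−β_j)`** (§15 p. 85, the display after (15.17),
tex L4230), for a coefficient sequence `b` (printed: `b = Skeleton.bcoef D = bLit D χ`; χ-absorbed reading
`bchi χ`); `n` over `1 ≤ n < ⌈P⌉`. DAG `Z22:§15.u037`. [cite: Zhang2022LandauSiegel, §15 p. 85] -/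
def calS1 (b : ℕ → ℂ) (j : ℕ) : ℂ :=
  ∑ n ∈ Finset.Ico 1 ⌈Skeleton.bigP D⌉₊, b n / (n : ℂ) *
    ∑ x ∈ n.divisorsAntidiagonal,
      lam1 c' χ x.1 1 * (x.1 : ℂ) ^ Skeleton.betaJ c' D j * χ (x.2 : ZMod D) *
        calM1 c' χ x.1 x.2 (1 - Skeleton.betaJ c' D j)

/-- **`ϖ_{1j}(n) = Σ_{n=dl} λ₁(d)d^{β_j}χ(l)ℳ₁(d,l;1−β_j)/ℳ₁(1,1;1−β_j)`** (§15 p. 85, the display after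
(15.19), tex L4244). DAG `Z22:§15.u038`. [cite: Zhang2022LandauSiegel, §15 p. 85] -/
def varpi1 (j n : ℕ) : ℂ :=
  ∑ x ∈ n.divisorsAntidiagonal,
    lam1 c' χ x.1 1 * (x.1 : ℂ) ^ Skeleton.betaJ c' D j * χ (x.2 : ZMod D) *
      (calM1 c' χ x.1 x.2 (1 - Skeleton.betaJ c' D j) / calM1 c' χ 1 1 (1 - Skeleton.betaJ c' D j))

/-- The integrand of **(15.14)** (§15 p. 84, tex L4186) as a function of `s`:
`(Σ_n λ̃₁(n,d)ξ₁(n;d,l)n^{−1−s}) · P₄^{s+β₃}d^{−s} · ω₁(s+β₃)/(s+β₃)` (the `n`-sum a series; `ω₁` =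
`GaussWeight.omega1 (𝓛³⁰)`, (4.1)). [cite: Zhang2022LandauSiegel, §15 (15.14) p. 84] -/
def integrand1514 (d l : ℕ) (s : ℂ) : ℂ :=
  (∑' n : ℕ, lamTilde1 c' χ n d * xi1 c' χ n d l / (n : ℂ) ^ (1 + s)) *
    ((Skeleton.P4 D : ℂ) ^ (s + Skeleton.beta3 c' D) / (d : ℂ) ^ s) *
    (GaussWeight.omega1 (Skeleton.ell D ^ 30) (s + Skeleton.beta3 c' D) / (s + Skeleton.beta3 c' D))

/-- The integrand of the display **§15.u036** (§15 p. 85, tex L4213) as a function of `s`: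
`ζ(1+s+β₁)ζ(1+s+β₂)ℳ₁(d,l;1+s)ζ(1+s)⁻¹L(1+s,χ)⁻¹ · P₄^{s+β₃}d^{−s} · ω₁(s+β₃)/(s+β₃)`.
[cite: Zhang2022LandauSiegel, §15 p. 85] -/
def integrandU036 [NeZero D] (d l : ℕ) (s : ℂ) : ℂ :=
  riemannZeta (1 + s + Skeleton.beta1 c' D) * riemannZeta (1 + s + Skeleton.beta2 c' D) *
      calM1 c' χ d l (1 + s) / (riemannZeta (1 + s) * χ.LFunction (1 + s)) *
    ((Skeleton.P4 D : ℂ) ^ (s + Skeleton.beta3 c' D) / (d : ℂ) ^ s) *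
    (GaussWeight.omega1 (Skeleton.ell D ^ 30) (s + Skeleton.beta3 c' D) / (s + Skeleton.beta3 c' D))

end Objects

/-! ## The displayed claims (15.12)–(15.21) and the proof-intermediate steps -/

section Claims

variable (c' : ℝ)

/-- **(15.12)** (§15 p. 83, tex L4162): "On substituting `n = mk` we can write
`𝒟₁(d,l) = Σ_n λ₁(dn)g̃₃(dn)n⁻¹ ξ₁(n;d,l)`" (`n` over `1 … ⌊2P₄⌋`, beyond which `g̃₃(dn) = 0`). CLAIM
(an identity of finite sums). DAG `Z22:(15.12)`. [cite: Zhang2022LandauSiegel, §15 (15.12) p. 83] -/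
def Eq15_12 : Prop :=
  ∀ (D : ℕ) [NeZero D] (χ : DirichletCharacter ℂ D) (d l : ℕ), 1 ≤ d → 1 ≤ l →
    calD1 c' χ d l =
      ∑ n ∈ Finset.Icc 1 ⌊2 * Skeleton.P4 D⌋₊,
        lam1 c' χ (d * n) 1 * gtilde3 c' D ((d * n : ℕ) : ℝ) / (n : ℂ) * xi1 c' χ n d l

/-- **p. 83 (inline, tex L4168): "It can be verified, for given `d` and `l`, that `ξ₁(n;d,l)` is a
multiplicative function of `n`."** CLAIM (no DAG display id). [cite: Zhang2022LandauSiegel, §15 p. 83] -/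
def Inline15_xi1Mult : Prop :=
  ∀ (D : ℕ) (χ : DirichletCharacter ℂ D) (d l : ℕ), 1 ≤ d → 1 ≤ l →
    xi1 c' χ 1 d l = 1 ∧
      ∀ m n : ℕ, Nat.Coprime m n → xi1 c' χ (m * n) d l = xi1 c' χ m d l * xi1 c' χ n d l

/-- **§15.u026** (§15 p. 83, tex L4170): "`λ₁(dn) = λ₁(d)λ̃₁(n,d)`". CLAIM (identity). DAG `Z22:§15.u026`.
[cite: Zhang2022LandauSiegel, §15 p. 83] -/
def Step15_u026 : Prop :=
  ∀ (D : ℕ) (χ : DirichletCharacter ℂ D) (d n : ℕ), 1 ≤ d → 1 ≤ n →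
    lam1 c' χ (d * n) 1 = lam1 c' χ d 1 * lamTilde1 c' χ n d

/-- **§15.u028** (§15 p. 84, tex L4178): "Hence `𝒟₁(d,l) = λ₁(d)Σ_n λ̃₁(n,d)ξ₁(n;d,l)g̃₃(dn)n⁻¹`".
CLAIM (identity; `n` over `1 … ⌊2P₄⌋`). DAG `Z22:§15.u028`. [cite: Zhang2022LandauSiegel, §15 p. 84] -/
def Step15_u028 : Prop :=
  ∀ (D : ℕ) [NeZero D] (χ : DirichletCharacter ℂ D) (d l : ℕ), 1 ≤ d → 1 ≤ l →
    calD1 c' χ d l =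
      lam1 c' χ d 1 * ∑ n ∈ Finset.Icc 1 ⌊2 * Skeleton.P4 D⌋₊,
        lamTilde1 c' χ n d * xi1 c' χ n d l * gtilde3 c' D ((d * n : ℕ) : ℝ) / (n : ℂ)

/-- **§15.u029** (§15 p. 84, tex L4182): "Since
`y^{β₃}g(P₄/y) = (1/2πi)∫_{(1)} P₄^{s+β₃}y^{−s} ω₁(s+β₃)(s+β₃)⁻¹ ds`" (`g` = `Skeleton.gW`, (4.1); for
`y > 0`; the line `s = 1 + it`). CLAIM. DAG `Z22:§15.u029`. [cite: Zhang2022LandauSiegel, §15 p. 84] -/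
def Step15_u029 : Prop :=
  Skeleton.ForAllLarge fun D _ _ => ∀ y : ℝ, 0 < y →
    (y : ℂ) ^ Skeleton.beta3 c' D * (Skeleton.gW D (Skeleton.P4 D / y) : ℂ) =
      (1 / (2 * π) : ℂ) * ∫ t : ℝ,
        (Skeleton.P4 D : ℂ) ^ (1 + t * I + Skeleton.beta3 c' D) / (y : ℂ) ^ (1 + t * I) *
          (GaussWeight.omega1 (Skeleton.ell D ^ 30) (1 + t * I + Skeleton.beta3 c' D) /
            (1 + t * I + Skeleton.beta3 c' D))

/-- **(15.14)** (§15 p. 84, tex L4186): "we can replace the factor `g̃₃(dn)` by `(dn)^{β₃}g(P₄/(dn))` with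
a negligible error … it follows that
`𝒟₁(d,l) = λ₁(d)·(1/2πi)∫_{(1)} (Σ_n λ̃₁(n,d)ξ₁(n;d,l)n^{−1−s}) P₄^{s+β₃}d^{−s} ω₁(s+β₃)(s+β₃)⁻¹ ds
+ O(ε)`" (`ε = exp{−c𝓛¹⁰}`; integrand = `integrand1514`, line `s = 1 + it`). CLAIM. DAG `Z22:(15.14)`.
[cite: Zhang2022LandauSiegel, §15 (15.14) p. 84] -/
def Eq15_14 : Prop :=
  ∃ c : ℝ, 0 < c ∧ ∃ C : ℝ, Skeleton.ForAllLarge fun D _ χ => Skeleton.AssumptionA D χ →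
    ∀ d l : ℕ, 1 ≤ d → 1 ≤ l →
      ‖calD1 c' χ d l -
          lam1 c' χ d 1 * ((1 / (2 * π) : ℂ) * ∫ t : ℝ, integrand1514 c' χ d l (1 + t * I))‖ ≤
        C * Real.exp (-c * Skeleton.ell D ^ 10)

/-- **p. 84 (inline, tex L4189): "Note that `λ̃₁(qʳ,d) = λ̃₁(q,d)` for any `r`"** (`r ≥ 1`, `q` prime).
CLAIM (no DAG display id). [cite: Zhang2022LandauSiegel, §15 p. 84] -/
def Inline15_lamTildePow : Prop :=
  ∀ (D : ℕ) (χ : DirichletCharacter ℂ D) (q d r : ℕ), Nat.Prime q → 1 ≤ r →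
    lamTilde1 c' χ (q ^ r) d = lamTilde1 c' χ q d

/-- **§15.u030** (§15 p. 84, tex L4191): "If `σ > 1`, then
`Σ_n λ̃₁(n,d)ξ₁(n;d,l)n^{−s} = ∏_q (1 + λ̃₁(q,d)Σ_r ξ₁(qʳ;d,l)q^{−rs})`" (Euler product over the primes).
CLAIM. DAG `Z22:§15.u030`. [cite: Zhang2022LandauSiegel, §15 p. 84] -/
def Step15_u030 : Prop :=
  ∀ (D : ℕ) (χ : DirichletCharacter ℂ D) (d l : ℕ), 1 ≤ d → 1 ≤ l → ∀ s : ℂ, 1 < s.re →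
    ∑' n : ℕ, lamTilde1 c' χ n d * xi1 c' χ n d l / (n : ℂ) ^ s =
      ∏' q : Nat.Primes, (1 + lamTilde1 c' χ (q : ℕ) d * xi1LocalSeries c' χ (q : ℕ) d l s)

/-- **§15.u031** (§15 p. 84, tex L4195): "If `(q,dl) = 1`, then
`ξ₁(q;d,l) = Σ_{h∈𝒩(q)} κ₁(qh)χ(h)h⁻¹ − χ(q)q/(q−1) = q^{−β₁} + q^{−β₂} − 1 − χ(q) + O(1/q)`"
(`q` prime; the first `=` an identity, the second with an absolute implied constant). CLAIM.
DAG `Z22:§15.u031`. [cite: Zhang2022LandauSiegel, §15 p. 84] -/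
def Step15_u031 : Prop :=
  ∃ C : ℝ, Skeleton.ForAllLarge fun D _ χ => Skeleton.AssumptionA D χ →
    ∀ q d l : ℕ, Nat.Prime q → 1 ≤ d → 1 ≤ l → Nat.Coprime q (d * l) →
      xi1 c' χ q d l = kappaTilde1 c' χ q 1 1 - χ (q : ZMod D) * (q : ℂ) / ((q : ℂ) - 1) ∧
        ‖xi1 c' χ q d l - ((q : ℂ) ^ (-Skeleton.beta1 c' D) + (q : ℂ) ^ (-Skeleton.beta2 c' D) - 1 -
            χ (q : ZMod D))‖ ≤ C / q

/-- **§15.u032** (§15 p. 84, tex L4199): for `(q,dl) = 1` and `σ > 9/10`, "`(1−q^{−s−β₁})(1−q^{−s−β₂})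
(1−q^{−s})⁻¹(1−χ(q)q^{−s})⁻¹ (1 + λ̃₁(q,d)Σ_r ξ₁(qʳ;d,l)q^{−rs}) = 1 + O(q^{−19/10})`" (absolute
implied constant). CLAIM. DAG `Z22:§15.u032`. [cite: Zhang2022LandauSiegel, §15 p. 84] -/
def Step15_u032 : Prop :=
  ∃ C : ℝ, Skeleton.ForAllLarge fun D _ χ => Skeleton.AssumptionA D χ →
    ∀ q d l : ℕ, Nat.Prime q → 1 ≤ d → 1 ≤ l → Nat.Coprime q (d * l) → ∀ s : ℂ, 9 / 10 < s.re →
      ‖calM1Factor c' χ q d l s - 1‖ ≤ C * (q : ℝ) ^ (-(19 / 10 : ℝ))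

/-- **§15.u033** (§15 p. 84, tex L4203): "In case `(q,dl) > 1` and `σ > 9/10`, the left side above is
trivially `1 + O(q^{−9/10})`." CLAIM. DAG `Z22:§15.u033`. [cite: Zhang2022LandauSiegel, §15 p. 84] -/
def Step15_u033 : Prop :=
  ∃ C : ℝ, Skeleton.ForAllLarge fun D _ χ => Skeleton.AssumptionA D χ →
    ∀ q d l : ℕ, Nat.Prime q → 1 ≤ d → 1 ≤ l → ¬ Nat.Coprime q (d * l) → ∀ s : ℂ, 9 / 10 < s.re →
      ‖calM1Factor c' χ q d l s - 1‖ ≤ C * (q : ℝ) ^ (-(9 / 10 : ℝ))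

/-- **§15.u034, the defining identity** (§15 p. 84, tex L4205): on `σ > 1` the Euler product `calM1`
equals the printed expression `ℳ₁(d,l;s) := ζ(s)L(s,χ)ζ(s+β₁)⁻¹ζ(s+β₂)⁻¹ Σ_n λ̃₁(n,d)ξ₁(n;d,l)n^{−s}`
(= u030 combined with the Euler products of `ζ` and `L(·,χ)`). CLAIM. DAG `Z22:§15.u034`.
[cite: Zhang2022LandauSiegel, §15 p. 84] -/
def Step15_u034 : Prop :=
  ∀ (D : ℕ) [NeZero D] (χ : DirichletCharacter ℂ D) (d l : ℕ), 1 ≤ d → 1 ≤ l →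
    ∀ s : ℂ, 1 < s.re → calM1 c' χ d l s = calM1Series c' χ d l s

/-- **§15.u034, "… is analytic … for `σ > 9/10`"** (§15 p. 84, tex L4205–4212): the Euler product
converges and `s ↦ ℳ₁(d,l;s)` is holomorphic on `σ > 9/10`. CLAIM. DAG `Z22:§15.u034`.
[cite: Zhang2022LandauSiegel, §15 p. 84] -/
def Step15_u034an : Prop :=
  Skeleton.ForAllLarge fun D _ χ => Skeleton.AssumptionA D χ → ∀ d l : ℕ, 1 ≤ d → 1 ≤ l →
    (∀ s : ℂ, 9 / 10 < s.re → Multipliable fun q : Nat.Primes => calM1Factor c' χ (q : ℕ) d l s) ∧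
      DifferentiableOn ℂ (fun s => calM1 c' χ d l s) {s : ℂ | 9 / 10 < s.re}

/-- **§15.u035** (§15 p. 84, tex L4209): "`ℳ₁(d,l;s) ≪ ∏_{q∣dl}(1 + cq^{−9/10})` for `σ > 9/10`".
CLAIM. DAG `Z22:§15.u035`. [cite: Zhang2022LandauSiegel, §15 p. 84] -/
def Step15_u035 : Prop :=
  ∃ c C : ℝ, Skeleton.ForAllLarge fun D _ χ => Skeleton.AssumptionA D χ →
    ∀ d l : ℕ, 1 ≤ d → 1 ≤ l → ∀ s : ℂ, 9 / 10 < s.re →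
      ‖calM1 c' χ d l s‖ ≤ C * ∏ q ∈ (d * l).primeFactors, (1 + c * (q : ℝ) ^ (-(9 / 10 : ℝ)))

/-- **§15.u036** (§15 p. 85, tex L4213): "The right side of (15.14) can be rewritten as
`λ₁(d)·(1/2πi)∫_{(1)} ζ(1+s+β₁)ζ(1+s+β₂)ℳ₁(d,l;1+s)ζ(1+s)⁻¹L(1+s,χ)⁻¹ P₄^{s+β₃}d^{−s}
ω₁(s+β₃)(s+β₃)⁻¹ ds + O(ε)`" — i.e. (15.14) with its integrand rewritten through u034 at `1 + s`
(`Re(1+s) = 2`; integrand = `integrandU036`, line `s = 1 + it`). CLAIM. DAG `Z22:§15.u036`. [cite: Zhang2022LandauSiegel, §15 p. 85] -/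
def Step15_u036 : Prop :=
  ∃ c : ℝ, 0 < c ∧ ∃ C : ℝ, Skeleton.ForAllLarge fun D _ χ => Skeleton.AssumptionA D χ →
    ∀ d l : ℕ, 1 ≤ d → 1 ≤ l →
      ‖calD1 c' χ d l -
          lam1 c' χ d 1 * ((1 / (2 * π) : ℂ) * ∫ t : ℝ, integrandU036 c' χ d l (1 + t * I))‖ ≤
        C * Real.exp (-c * Skeleton.ell D ^ 10)

/-- **p. 85 (inline, tex L4217): "Assume `dl < PT⁻²`, and `(dl,D) = 1`. Note that `P₄/d > T`."**
Typed AS PRINTED. TYPER'S FLAG (not a repair): with `P₄ = PT⁻²t₀` (§6 p. 12, tex L1689) the assumption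
`dl < PT⁻²` yields only `P₄/d > t₀·l`, and `t₀ = 𝓛⁵¹⁹ < T = exp{𝓛^{1.1}}` for large `D`; the remark is
what lets the manuscript evaluate (15.15) "in a way similar to the proof of Lemma 8.4" (which needs a
length `> T`). CLAIM (no DAG display id). [cite: Zhang2022LandauSiegel, §15 p. 85] -/
def Inline15_P4d : Prop :=
  Skeleton.ForAllLarge fun D _ χ => Skeleton.AssumptionA D χ →
    ∀ d l : ℕ, 1 ≤ d → 1 ≤ l → ((d * l : ℕ) : ℝ) < Skeleton.bigP D / Skeleton.bigT D ^ 2 →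
      Nat.Coprime (d * l) D → Skeleton.bigT D < Skeleton.P4 D / d

/-- **(15.15)** (§15 p. 85, tex L4218): "Assume `dl < PT⁻²`, and `(dl,D) = 1`. … In a way similar to the
proof of Lemma 8.4, we deduce that `𝒟₁(d,l) = λ₁(d)Σ_{j≤3} ℛ_{1j}d^{β_j}ℳ₁(d,l;1−β_j) + O(ε₁)`"
(`ε₁ = exp{−c𝓛^{1/10}}`; "(15.16) also has a simple pole at `s = ρ̃ − 1`, while the residue at this
point can be regarded as an acceptable error"). CLAIM. DAG `Z22:(15.15)`.
[cite: Zhang2022LandauSiegel, §15 (15.15) p. 85] -/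
def Eq15_15 : Prop :=
  ∃ c : ℝ, 0 < c ∧ ∃ C : ℝ, Skeleton.ForAllLarge fun D _ χ => Skeleton.AssumptionA D χ →
    ∀ d l : ℕ, 1 ≤ d → 1 ≤ l → ((d * l : ℕ) : ℝ) < Skeleton.bigP D / Skeleton.bigT D ^ 2 →
      Nat.Coprime (d * l) D →
        ‖calD1 c' χ d l -
            lam1 c' χ d 1 * ∑ j ∈ ({1, 2, 3} : Finset ℕ),
              calR1 c' χ j * (d : ℂ) ^ Skeleton.betaJ c' D j *
                calM1 c' χ d l (1 - Skeleton.betaJ c' D j)‖ ≤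
          C * Real.exp (-c * Skeleton.ell D ^ (1 / 10 : ℝ))

/-- **(15.17)** (§15 p. 85, tex L4226): "Inserting this into (15.11) and substituting `n = dl` we obtain
`Φ₁(p) = ℛ₁*Dp φ(D)⁻¹ Σ_{j≤3} ℛ_{1j}𝒮_{1j} + o(p)`" (for the primes `p ∼ P` of (15.6), `Skeleton.primeWindow`;
`Φ₁(p)` = `Section15A.Phi1pOf … (b D χ)`, `ℛ₁*` = `Section15A.calR1star`), for a coefficient family `b`
(printed node: `b = bLit`, then `Phi1pOf … = Section15A.Phi1p`, `Phi1p_eq_Phi1pOf_bLit`; reading `bChi`,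
as in `Section15A.Eq15_11`). CLAIM. DAG `Z22:(15.17)`. [cite: Zhang2022LandauSiegel, §15 (15.17) p. 85] -/
def Eq15_17 (b : CoefFam) : Prop :=
  ∀ ε : ℝ, 0 < ε → Skeleton.ForAllLarge fun D _ χ => Skeleton.AssumptionA D χ →
    ∀ p ∈ Skeleton.primeWindow D,
      ‖Phi1pOf c' χ (b D χ) p -
          calR1star c' χ * (D : ℂ) * (p : ℂ) / (Nat.totient D : ℂ) *
            ∑ j ∈ ({1, 2, 3} : Finset ℕ), calR1 c' χ j * calS1 c' χ (b D χ) j‖ ≤ ε * p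

/-- (15.17) at the printed coefficients is a statement about the printed `Φ₁(p)` = `Section15A.Phi1p`
(`Phi1p c′ χ p = Phi1pOf c′ χ (Skeleton.bcoef D) p = Phi1pOf c′ χ (bLit D χ) p`, definitionally).
[cite: Zhang2022LandauSiegel, §15 (15.17) p. 85] -/
theorem Phi1p_eq_Phi1pOf_bLit {D : ℕ} [NeZero D] (χ : DirichletCharacter ℂ D) (p : ℕ) :
    Phi1p c' χ p = Phi1pOf c' χ (bLit D χ) p := rfl

/-- **p. 85 (inline, tex L4232): "If `(q,dl) = 1`, then `λ̃₁(q,d) = λ̃₁(q,1)` and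
`ξ₁(qʳ;d,l) = ξ₁(qʳ;1,1)` for any `r`."** (`q` prime, `r ≥ 1`.) CLAIM (no DAG display id).
[cite: Zhang2022LandauSiegel, §15 p. 85] -/
def Inline15_localEq : Prop :=
  ∀ (D : ℕ) (χ : DirichletCharacter ℂ D) (q d l r : ℕ), Nat.Prime q → 1 ≤ d → 1 ≤ l → 1 ≤ r →
    Nat.Coprime q (d * l) →
      lamTilde1 c' χ q d = lamTilde1 c' χ q 1 ∧ xi1 c' χ (q ^ r) d l = xi1 c' χ (q ^ r) 1 1

/-- **(15.18)** (§15 p. 85, tex L4235): "Hence `ℳ₁(d,l;s)/ℳ₁(1,1;s) = ∏_{q∣dl} (1 + λ̃₁(q,d)Σ_r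
ξ₁(qʳ;d,l)q^{−rs})(1 + λ̃₁(q,1)Σ_r ξ₁(qʳ;1,1)q^{−rs})⁻¹`" (on the domain `σ > 9/10` of u034; typed with
the printed division, no non-vanishing hypothesis added). CLAIM. DAG `Z22:(15.18)`.
[cite: Zhang2022LandauSiegel, §15 (15.18) p. 85] -/
def Eq15_18 : Prop :=
  Skeleton.ForAllLarge fun D _ χ => Skeleton.AssumptionA D χ →
    ∀ d l : ℕ, 1 ≤ d → 1 ≤ l → ∀ s : ℂ, 9 / 10 < s.re →
      calM1 c' χ d l s / calM1 c' χ 1 1 s =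
        ∏ q ∈ (d * l).primeFactors,
          (1 + lamTilde1 c' χ q d * xi1LocalSeries c' χ q d l s) *
            (1 + lamTilde1 c' χ q 1 * xi1LocalSeries c' χ q 1 1 s)⁻¹

/-- **(15.19)** (§15 p. 85, tex L4240): "We can rewrite `𝒮_{1j} = ℳ₁(1,1;1−β_j)Σ_n b(n)ϖ_{1j}(n)n⁻¹`"
(`1 ≤ j ≤ 3`; `n` over `1 ≤ n < ⌈P⌉`; coefficient family `b`, printed node `b = bLit`).
CLAIM (identity). DAG `Z22:(15.19)`.
[cite: Zhang2022LandauSiegel, §15 (15.19) p. 85] -/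
def Eq15_19 (b : CoefFam) : Prop :=
  Skeleton.ForAllLarge fun D _ χ => Skeleton.AssumptionA D χ → ∀ j ∈ ({1, 2, 3} : Finset ℕ),
    calS1 c' χ (b D χ) j =
      calM1 c' χ 1 1 (1 - Skeleton.betaJ c' D j) *
        ∑ n ∈ Finset.Ico 1 ⌈Skeleton.bigP D⌉₊, b D χ n * varpi1 c' χ j n / (n : ℂ)

/-- **p. 85 (inline, tex L4246): "In view of (15.18), we see that `ϖ_{1j}(n)` is a multiplicative
function."** CLAIM (no DAG display id). [cite: Zhang2022LandauSiegel, §15 p. 85] -/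
def Inline15_varpiMult : Prop :=
  Skeleton.ForAllLarge fun D _ χ => Skeleton.AssumptionA D χ → ∀ j ∈ ({1, 2, 3} : Finset ℕ),
    varpi1 c' χ j 1 = 1 ∧
      ∀ m n : ℕ, Nat.Coprime m n → varpi1 c' χ j (m * n) = varpi1 c' χ j m * varpi1 c' χ j n

open scoped Classical in
/-- **(15.20)** (§15 p. 86, tex L4254): with `𝒬 = ∏_{q<D⁴} q` (`Skeleton.frakq`), "Every `n` can be
uniquely written as `n = n₁n₂` with `n₁ ∈ 𝒩(𝒬)` and `(n₂,𝒬) = 1`. Hence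
`Σ_n b(n)ϖ_{1j}(n)n⁻¹ = Σ_{n₁∈𝒩(𝒬)} ϖ_{1j}(n₁)n₁⁻¹ Σ_{(n,𝒬)=1} b(n₁n)ϖ_{1j}(n)n⁻¹`" (all sums over
`1 ≤ · < ⌈P⌉`, cf. `Skeleton.Lemma151`; coefficient family `b`, printed node `b = bLit`). CLAIM.
DAG `Z22:(15.20)`.
[cite: Zhang2022LandauSiegel, §15 (15.20) p. 86] -/
def Eq15_20 (b : CoefFam) : Prop :=
  Skeleton.ForAllLarge fun D _ χ => Skeleton.AssumptionA D χ → ∀ j ∈ ({1, 2, 3} : Finset ℕ),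
    ∑ n ∈ Finset.Ico 1 ⌈Skeleton.bigP D⌉₊, b D χ n * varpi1 c' χ j n / (n : ℂ) =
      ∑ n₁ ∈ (Finset.Ico 1 ⌈Skeleton.bigP D⌉₊).filter (fun n₁ => n₁ ∈ Skeleton.nset (Skeleton.frakq D)),
        varpi1 c' χ j n₁ / (n₁ : ℂ) *
          ∑ n ∈ (Finset.Ico 1 ⌈Skeleton.bigP D⌉₊).filter (fun n => Nat.Coprime n (Skeleton.frakq D)),
            b D χ (n₁ * n) * varpi1 c' χ j n / (n : ℂ)

open scoped Classical in
/-- **p. 86 (inline, tex L4257): "Using the Rankin trick (see [14, Section 13.2], for example), we can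
impose the constraint `n₁ < T` to the right side [of (15.20)] with an acceptable error `O(ε₁)`."**
(coefficient family `b`, printed node `b = bLit`). CLAIM (no DAG display id). [cite: Zhang2022LandauSiegel, §15 p. 86] -/
def Inline15_Rankin (b : CoefFam) : Prop :=
  ∃ c : ℝ, 0 < c ∧ ∃ C : ℝ, Skeleton.ForAllLarge fun D _ χ => Skeleton.AssumptionA D χ →
    ∀ j ∈ ({1, 2, 3} : Finset ℕ),
      ‖(∑ n₁ ∈ (Finset.Ico 1 ⌈Skeleton.bigP D⌉₊).filter
            (fun n₁ => n₁ ∈ Skeleton.nset (Skeleton.frakq D)),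
          varpi1 c' χ j n₁ / (n₁ : ℂ) *
            ∑ n ∈ (Finset.Ico 1 ⌈Skeleton.bigP D⌉₊).filter (fun n => Nat.Coprime n (Skeleton.frakq D)),
              b D χ (n₁ * n) * varpi1 c' χ j n / (n : ℂ)) -
        ∑ n₁ ∈ (Finset.Ico 1 ⌈Skeleton.bigP D⌉₊).filter
            (fun n₁ => n₁ ∈ Skeleton.nset (Skeleton.frakq D) ∧ (n₁ : ℝ) < Skeleton.bigT D),
          varpi1 c' χ j n₁ / (n₁ : ℂ) *
            ∑ n ∈ (Finset.Ico 1 ⌈Skeleton.bigP D⌉₊).filter (fun n => Nat.Coprime n (Skeleton.frakq D)),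
              b D χ (n₁ * n) * varpi1 c' χ j n / (n : ℂ)‖ ≤
        C * Real.exp (-c * Skeleton.ell D ^ (1 / 10 : ℝ))

/-- **§15.u040** (§15 p. 86, tex L4258): "by (15.18), for `n < PT⁻³`, `(n,𝒬) = 1` and `dl = n`,
`λ₁(d)ℳ₁(d,l;s)/ℳ₁(1,1;s) = 1 + O(D^{−c})`" — the display prints a generic `s`; it is applied (next line,
"so that (15.21)") at `s = 1 − β_j`, `1 ≤ j ≤ 3`, which is how it is typed. CLAIM. DAG `Z22:§15.u040`.
[cite: Zhang2022LandauSiegel, §15 p. 86] -/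
def Step15_u040 : Prop :=
  ∃ c : ℝ, 0 < c ∧ ∃ C : ℝ, Skeleton.ForAllLarge fun D _ χ => Skeleton.AssumptionA D χ →
    ∀ j ∈ ({1, 2, 3} : Finset ℕ), ∀ n d l : ℕ, 1 ≤ n → d * l = n →
      (n : ℝ) < Skeleton.bigP D / Skeleton.bigT D ^ 3 → Nat.Coprime n (Skeleton.frakq D) →
        ‖lam1 c' χ d 1 * calM1 c' χ d l (1 - Skeleton.betaJ c' D j) /
              calM1 c' χ 1 1 (1 - Skeleton.betaJ c' D j) - 1‖ ≤
          C * (D : ℝ) ^ (-c)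

/-- **(15.21)** (§15 p. 86, tex L4262): for `n < PT⁻³` and `(n,𝒬) = 1`, "`ϖ_{1j}(n) = χ(n)ϱ*_j(n) +
O(τ₂(n)D^{−c})` where `ϱ*_j(n) = Σ_{d∣n} d^{β_j}χ(d)`" (`ϱ*_j` = the banked `Skeleton.varrhoStar`).
CLAIM. DAG `Z22:(15.21)` (and `Z22:§15.u041` = `Skeleton.varrhoStar`, cited).
[cite: Zhang2022LandauSiegel, §15 (15.21) p. 86] -/
def Eq15_21 : Prop :=
  ∃ c : ℝ, 0 < c ∧ ∃ C : ℝ, Skeleton.ForAllLarge fun D _ χ => Skeleton.AssumptionA D χ →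
    ∀ j ∈ ({1, 2, 3} : Finset ℕ), ∀ n : ℕ, 1 ≤ n → (n : ℝ) < Skeleton.bigP D / Skeleton.bigT D ^ 3 →
      Nat.Coprime n (Skeleton.frakq D) →
        ‖varpi1 c' χ j n - χ (n : ZMod D) * Skeleton.varrhoStar c' χ j n‖ ≤
          C * (n.divisors.card : ℝ) * (D : ℝ) ^ (-c)

end Claims


/-! ## Kernel edges: the pure identities of this slice -/

section Edges

variable (c' : ℝ)

/-- **§15.u026 holds**: `λ₁(dn) = λ₁(d)λ̃₁(n,d)` (the prime factors of `dn` are those of `d` together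
with those of `n` coprime to `d`). [cite: Zhang2022LandauSiegel, §15 p. 83] -/
theorem step15_u026_holds : Step15_u026 c' := by
  intro D χ d n hd hn
  have hd0 : d ≠ 0 := by omega
  have hn0 : n ≠ 0 := by omega
  have hsplit : (d * n).primeFactors =
      d.primeFactors ∪ n.primeFactors.filter (fun q => Nat.Coprime q d) := by
    ext q
    simp only [Nat.primeFactors_mul hd0 hn0, Finset.mem_union, Finset.mem_filter]
    constructor
    · rintro (h | h)
      · exact Or.inl h
      · by_cases hq : q ∈ d.primeFactors
        · exact Or.inl hq
        · refine Or.inr ⟨h, ?_⟩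
          have hqp : q.Prime := Nat.prime_of_mem_primeFactors h
          exact (Nat.Prime.coprime_iff_not_dvd hqp).mpr
            (fun hdvd => hq (Nat.mem_primeFactors.mpr ⟨hqp, hdvd, hd0⟩))
    · rintro (h | ⟨h, _⟩)
      · exact Or.inl h
      · exact Or.inr h
  have hdisj : Disjoint d.primeFactors (n.primeFactors.filter (fun q => Nat.Coprime q d)) := by
    rw [Finset.disjoint_left]
    intro q hq hq'
    have hqp : q.Prime := Nat.prime_of_mem_primeFactors hq
    have hcop := (Finset.mem_filter.mp hq').2
    exact (Nat.Prime.coprime_iff_not_dvd hqp).mp hcop (Nat.dvd_of_mem_primeFactors hq)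
  unfold lamTilde1 lam1
  rw [hsplit, Finset.prod_union hdisj]
  congr 1
  refine Finset.prod_congr rfl fun q hq => ?_
  rw [(Nat.prime_of_mem_primeFactors (Finset.mem_filter.mp hq).1).primeFactors, Finset.prod_singleton]

/-- `Step15_u026` — `_holds` alias of `step15_u026_holds` above under the fact's exact name (appended
2026-08-28, D-0026 bookkeeping: the proof term is the existing theorem of this file; no statement,
definition or attribute is edited; no new named fact; the ledger's debt table listed the fact
unproved). [cite: Zhang2022LandauSiegel, §15 p. 83] -/
theorem _root_.Literature.NumberTheory.LFunctions.Zhang2022.Typed.Section15B.Step15_u026_holds :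
    Step15_u026 c' :=
  _root_.Literature.NumberTheory.LFunctions.Zhang2022.Typed.Section15B.step15_u026_holds (c' := c')

/-- **p. 84 inline claim holds**: `λ̃₁(qʳ,d) = λ̃₁(q,d)` (`qʳ` and `q` have the same prime factors).
[cite: Zhang2022LandauSiegel, §15 p. 84] -/
theorem inline15_lamTildePow_holds : Inline15_lamTildePow c' := by
  intro D χ q d r hq hr
  unfold lamTilde1
  rw [Nat.primeFactors_prime_pow (by omega) hq, hq.primeFactors]

/-- `Inline15_lamTildePow` — `_holds` alias of `inline15_lamTildePow_holds` above under the fact's exact name (appended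
2026-08-28, D-0026 bookkeeping: the proof term is the existing theorem of this file; no statement,
definition or attribute is edited; no new named fact; the ledger's debt table listed the fact
unproved). [cite: Zhang2022LandauSiegel, §15 p. 84] -/
theorem _root_.Literature.NumberTheory.LFunctions.Zhang2022.Typed.Section15B.Inline15_lamTildePow_holds :
    Inline15_lamTildePow c' :=
  _root_.Literature.NumberTheory.LFunctions.Zhang2022.Typed.Section15B.inline15_lamTildePow_holds (c' := c')

/-- **p. 85 inline claim holds**: if `(q,dl) = 1` then `λ̃₁(q,d) = λ̃₁(q,1)` and
`ξ₁(qʳ;d,l) = ξ₁(qʳ;1,1)` (every divisor of `qʳ` is coprime to `l`, and an `h ∈ 𝒩(qʳ/k)` is a power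
of `q`, hence coprime to `d`). [cite: Zhang2022LandauSiegel, §15 p. 85] -/
theorem inline15_localEq_holds : Inline15_localEq c' := by
  intro D χ q d l r hq hd hl hr hcop
  have hqd : Nat.Coprime q d := Nat.Coprime.coprime_dvd_right (Dvd.intro l rfl) hcop
  have hql : Nat.Coprime q l := Nat.Coprime.coprime_dvd_right (Dvd.intro_left d rfl) hcop
  constructor
  · unfold lamTilde1
    rw [hq.primeFactors, Finset.filter_singleton, Finset.filter_singleton, if_pos hqd,
      if_pos (Nat.coprime_one_right q)]
  · unfold xi1
    have hfilt : (q ^ r).divisors.filter (fun k => Nat.Coprime k l) = (q ^ r).divisors := by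
      refine Finset.filter_true_of_mem fun k hk => ?_
      exact Nat.Coprime.coprime_dvd_left (Nat.dvd_of_mem_divisors hk) (Nat.Coprime.pow_left r hql)
    have hfilt1 : (q ^ r).divisors.filter (fun k => Nat.Coprime k 1) = (q ^ r).divisors :=
      Finset.filter_true_of_mem fun k _ => Nat.coprime_one_right k
    rw [hfilt, hfilt1]
    refine Finset.sum_congr rfl fun k hk => ?_
    congr 1
    unfold kappaTilde1
    refine tsum_congr fun h => ?_
    have hiff : (h ∈ Skeleton.nset (q ^ r / k) ∧ Nat.Coprime h (d * k)) ↔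
        (h ∈ Skeleton.nset (q ^ r / k) ∧ Nat.Coprime h (1 * k)) := by
      rw [one_mul, Nat.coprime_mul_iff_right]
      constructor
      · rintro ⟨hn, -, hk'⟩
        exact ⟨hn, hk'⟩
      · rintro ⟨hn, hk'⟩
        refine ⟨hn, ?_, hk'⟩
        refine Nat.coprime_of_dvd fun p hp hph hpd => ?_
        have hpm : p ∣ q ^ r / k := hn.2 p hp hph
        have hpq : p ∣ q ^ r := dvd_trans hpm (Nat.div_dvd_of_dvd (Nat.dvd_of_mem_divisors hk))
        have hpq' : p = q := (Nat.prime_dvd_prime_iff_eq hp hq).mp (hp.dvd_of_dvd_pow hpq)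
        subst hpq'
        exact (Nat.Prime.coprime_iff_not_dvd hp).mp hqd hpd
    by_cases h1 : h ∈ Skeleton.nset (q ^ r / k) ∧ Nat.Coprime h (d * k)
    · rw [if_pos h1, if_pos (hiff.mp h1)]
    · rw [if_neg h1, if_neg (fun h2 => h1 (hiff.mpr h2))]

/-- `Inline15_localEq` — `_holds` alias of `inline15_localEq_holds` above under the fact's exact name (appended
2026-08-28, D-0026 bookkeeping: the proof term is the existing theorem of this file; no statement,
definition or attribute is edited; no new named fact; the ledger's debt table listed the fact
unproved). [cite: Zhang2022LandauSiegel, §15 p. 85] -/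
theorem _root_.Literature.NumberTheory.LFunctions.Zhang2022.Typed.Section15B.Inline15_localEq_holds :
    Inline15_localEq c' :=
  _root_.Literature.NumberTheory.LFunctions.Zhang2022.Typed.Section15B.inline15_localEq_holds (c' := c')

/-- Re-indexing `n = mk` behind (15.12): a double sum over `k ≤ N` (restricted by a predicate `P`)
and `m ≤ N` whose terms vanish for `km > N` equals the sum over `n ≤ N` and the divisors `k` of `n`
with `P k`, the second variable becoming `n/k` — the "substituting `n = mk`" of (15.12) (and of (16.6)).
[cite: Zhang2022LandauSiegel, §15 (15.12) p. 83] -/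
theorem sum_Icc_filter_sum_Icc_eq_sum_divisors {N : ℕ} (P : ℕ → Prop) [DecidablePred P]
    (F : ℕ → ℕ → ℂ) (hF : ∀ k m, 1 ≤ k → 1 ≤ m → N < k * m → F k m = 0) :
    ∑ k ∈ (Finset.Icc 1 N).filter P, ∑ m ∈ Finset.Icc 1 N, F k m =
      ∑ n ∈ Finset.Icc 1 N, ∑ k ∈ n.divisors.filter P, F k (n / k) := by
  rw [Finset.sum_sigma', Finset.sum_sigma']
  rw [← Finset.sum_filter_of_ne (p := fun x : (_ : ℕ) × ℕ => x.1 * x.2 ≤ N)]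
  · refine Finset.sum_bij' (fun x _ => (⟨x.1 * x.2, x.1⟩ : (_ : ℕ) × ℕ))
      (fun y _ => (⟨y.2, y.1 / y.2⟩ : (_ : ℕ) × ℕ)) ?_ ?_ ?_ ?_ ?_
    · rintro ⟨k, m⟩ hx
      simp only [Finset.mem_filter, Finset.mem_sigma, Finset.mem_Icc] at hx
      obtain ⟨⟨⟨⟨hk1, -⟩, hP⟩, hm1, -⟩, hkm⟩ := hx
      simp only [Finset.mem_sigma, Finset.mem_Icc, Finset.mem_filter, Nat.mem_divisors]
      refine ⟨⟨?_, hkm⟩, ⟨Dvd.intro m rfl, ?_⟩, hP⟩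
      · exact le_trans hk1 (Nat.le_mul_of_pos_right k hm1)
      · exact Nat.mul_ne_zero (by omega) (by omega)
    · rintro ⟨n, k⟩ hy
      simp only [Finset.mem_sigma, Finset.mem_Icc, Finset.mem_filter, Nat.mem_divisors] at hy
      obtain ⟨⟨hn1, hnN⟩, ⟨hkn, hn0⟩, hP⟩ := hy
      have hk0 : 0 < k := Nat.pos_of_dvd_of_pos hkn (by omega)
      have hkn' : k ≤ n := Nat.le_of_dvd (by omega) hkn
      simp only [Finset.mem_filter, Finset.mem_sigma, Finset.mem_Icc]
      refine ⟨⟨⟨⟨hk0, le_trans hkn' hnN⟩, hP⟩, ?_, ?_⟩, ?_⟩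
      · exact Nat.div_pos hkn' hk0
      · exact le_trans (Nat.div_le_self n k) hnN
      · rw [Nat.mul_div_cancel' hkn]; exact hnN
    · rintro ⟨k, m⟩ hx
      simp only [Finset.mem_filter, Finset.mem_sigma, Finset.mem_Icc] at hx
      obtain ⟨⟨⟨⟨hk1, -⟩, -⟩, -, -⟩, -⟩ := hx
      simp only [Nat.mul_div_cancel_left m (by omega : 0 < k)]
    · rintro ⟨n, k⟩ hy
      simp only [Finset.mem_sigma, Finset.mem_Icc, Finset.mem_filter, Nat.mem_divisors] at hy
      obtain ⟨-, ⟨hkn, -⟩, -⟩ := hy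
      simp only [Nat.mul_div_cancel' hkn]
    · rintro ⟨k, m⟩ hx
      simp only [Finset.mem_filter, Finset.mem_sigma, Finset.mem_Icc] at hx
      obtain ⟨⟨⟨⟨hk1, -⟩, -⟩, -, -⟩, -⟩ := hx
      simp only [Nat.mul_div_cancel_left m (by omega : 0 < k)]
  · rintro ⟨k, m⟩ hx hne
    simp only [Finset.mem_sigma, Finset.mem_filter, Finset.mem_Icc] at hx
    obtain ⟨⟨⟨hk1, -⟩, -⟩, hm1, -⟩ := hx
    by_contra hlt
    exact hne (hF k m hk1 hm1 (not_le.mp hlt))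

/-- `g̃₃(mdk) = 0` once `km > ⌊2P₄⌋` (`d ≥ 1`): then `P₄/(mdk) < 1/2` and `g*` vanishes.
[cite: Zhang2022LandauSiegel, §6 p. 12] -/
theorem gtilde3_eq_zero_of_lt {D : ℕ} {d k m : ℕ} (hd : 1 ≤ d) (hk : 1 ≤ k) (hm : 1 ≤ m)
    (hkm : ⌊2 * Skeleton.P4 D⌋₊ < k * m) : gtilde3 c' D ((m * d * k : ℕ) : ℝ) = 0 := by
  unfold gtilde3 Skeleton.gstar
  have hkm' : ⌊2 * Skeleton.P4 D⌋₊ + 1 ≤ k * m := hkm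
  have hle : k * m ≤ m * d * k :=
    calc k * m = k * m * 1 := (mul_one _).symm
      _ ≤ k * m * d := Nat.mul_le_mul_left _ hd
      _ = m * d * k := by ring
  have h1 : (2 : ℝ) * Skeleton.P4 D < (⌊2 * Skeleton.P4 D⌋₊ : ℝ) + 1 := Nat.lt_floor_add_one _
  have h2 : (⌊2 * Skeleton.P4 D⌋₊ : ℝ) + 1 ≤ ((k * m : ℕ) : ℝ) := by exact_mod_cast hkm'
  have h3 : ((k * m : ℕ) : ℝ) ≤ ((m * d * k : ℕ) : ℝ) := by exact_mod_cast hle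
  have hpos : (0 : ℝ) < ((m * d * k : ℕ) : ℝ) := by
    have : 0 < m * d * k := Nat.mul_pos (Nat.mul_pos (by omega) (by omega)) (by omega)
    exact_mod_cast this
  have hlt : ¬ (1 / 2 : ℝ) < Skeleton.P4 D / ((m * d * k : ℕ) : ℝ) := by
    rw [not_lt, div_le_iff₀ hpos]
    linarith
  rw [if_neg hlt]
  simp

/-- **(15.12) holds**: the substitution `n = mk` (terms with `mk > 2P₄` vanish because `g̃₃` does).
[cite: Zhang2022LandauSiegel, §15 (15.12) p. 83] -/
theorem eq15_12_holds : Eq15_12 c' := by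
  intro D _ χ d l hd hl
  unfold calD1 xi1
  simp_rw [Finset.mul_sum]
  rw [sum_Icc_filter_sum_Icc_eq_sum_divisors (fun k => Nat.Coprime k l)]
  · refine Finset.sum_congr rfl fun n hn => Finset.sum_congr rfl fun k hk => ?_
    have hkn : k ∣ n := Nat.dvd_of_mem_divisors (Finset.mem_filter.mp hk).1
    have hn0 : n ≠ 0 := by have := (Finset.mem_Icc.mp hn).1; omega
    have hk0 : k ≠ 0 := fun h => hn0 (Nat.eq_zero_of_zero_dvd (h ▸ hkn))
    have e1 : n / k * d * k = d * n := by
      calc n / k * d * k = d * (n / k * k) := by ring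
        _ = d * n := by rw [Nat.div_mul_cancel hkn]
    have e2 : ((n / k : ℕ) : ℂ) = (n : ℂ) / (k : ℂ) := Nat.cast_div hkn (by exact_mod_cast hk0)
    rw [e1, e2]
    have hkC : (k : ℂ) ≠ 0 := by exact_mod_cast hk0
    have hnC : (n : ℂ) ≠ 0 := by exact_mod_cast hn0
    field_simp
  · intro k m hk1 hm1 hkm
    rw [gtilde3_eq_zero_of_lt c' hd hk1 hm1 hkm]
    simp

/-- `Eq15_12` — `_holds` alias of `eq15_12_holds` above under the fact's exact name (appended
2026-08-28, D-0026 bookkeeping: the proof term is the existing theorem of this file; no statement,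
definition or attribute is edited; no new named fact; the ledger's debt table listed the fact
unproved). [cite: Zhang2022LandauSiegel, §15 (15.12) p. 83] -/
theorem _root_.Literature.NumberTheory.LFunctions.Zhang2022.Typed.Section15B.Eq15_12_holds :
    Eq15_12 c' :=
  _root_.Literature.NumberTheory.LFunctions.Zhang2022.Typed.Section15B.eq15_12_holds (c' := c')

/-- **§15.u028 holds**: from (15.12) and `λ₁(dn) = λ₁(d)λ̃₁(n,d)` (§15.u026).
[cite: Zhang2022LandauSiegel, §15 p. 84] -/
theorem step15_u028_holds : Step15_u028 c' := by
  intro D _ χ d l hd hl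
  rw [eq15_12_holds c' D χ d l hd hl, Finset.mul_sum]
  refine Finset.sum_congr rfl fun n hn => ?_
  have hn1 : 1 ≤ n := (Finset.mem_Icc.mp hn).1
  rw [step15_u026_holds c' D χ d n hd hn1]
  ring

/-- `Step15_u028` — `_holds` alias of `step15_u028_holds` above under the fact's exact name (appended
2026-08-28, D-0026 bookkeeping: the proof term is the existing theorem of this file; no statement,
definition or attribute is edited; no new named fact; the ledger's debt table listed the fact
unproved). [cite: Zhang2022LandauSiegel, §15 p. 84] -/
theorem _root_.Literature.NumberTheory.LFunctions.Zhang2022.Typed.Section15B.Step15_u028_holds :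
    Step15_u028 c' :=
  _root_.Literature.NumberTheory.LFunctions.Zhang2022.Typed.Section15B.step15_u028_holds (c' := c')

/-- `𝒩(1) = {1}`: a positive integer all of whose prime factors divide `1` is `1`.
[cite: Zhang2022LandauSiegel, §7 p. 13] -/
theorem eq_one_of_mem_nset_one {h : ℕ} (hh : h ∈ Skeleton.nset 1) : h = 1 := by
  by_contra hne
  obtain ⟨p, hp, hph⟩ := Nat.exists_prime_and_dvd hne
  have : p ≤ 1 := Nat.le_of_dvd Nat.one_pos (hh.2 p hp hph)
  exact absurd hp.one_lt (not_lt.mpr this)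

/-- `κ̃₁(1;r,1) = 1` (only `h = 1` contributes; `κ₁(1) = 1`). [cite: Zhang2022LandauSiegel, §15 (15.9) p. 82] -/
theorem kappaTilde1_one {D : ℕ} (χ : DirichletCharacter ℂ D) (r : ℕ) :
    kappaTilde1 c' χ 1 r 1 = 1 := by
  classical
  unfold kappaTilde1
  rw [tsum_eq_single 1]
  · have h1 : (1 : ℕ) ∈ Skeleton.nset 1 ∧ Nat.Coprime 1 r :=
      ⟨⟨Nat.one_pos, fun p _ hp => hp⟩, Nat.coprime_one_left _⟩
    rw [if_pos h1]
    have hk : kappa1 c' D 1 = 1 := (MeanSquareMajorant.isMultiplicative_kappa₁ _ _).map_one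
    simp [hk]
  · intro h hne
    rw [if_neg]
    rintro ⟨hh, -⟩
    exact hne (eq_one_of_mem_nset_one hh)

/-- **The identity half of §15.u031**: for a prime `q` with `(q,dl) = 1`,
`ξ₁(q;d,l) = Σ_{h∈𝒩(q)} κ₁(qh)χ(h)h⁻¹ − χ(q)q/(q−1)` (the first sum is `κ̃₁(q;1,1)`): the divisors of
`q` are `1, q`, both coprime to `l`; `μ(q) = −1`, `φ(q) = q − 1`, `κ̃₁(1;dq) = 1`, and
`κ̃₁(q;d) = κ̃₁(q;1)` since every `h ∈ 𝒩(q)` is coprime to `d`. [cite: Zhang2022LandauSiegel, §15 p. 84] -/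
theorem xi1_prime_eq {D : ℕ} (χ : DirichletCharacter ℂ D) {q d l : ℕ} (hq : q.Prime)
    (hcop : Nat.Coprime q (d * l)) :
    xi1 c' χ q d l = kappaTilde1 c' χ q 1 1 - χ (q : ZMod D) * (q : ℂ) / ((q : ℂ) - 1) := by
  classical
  have hqd : Nat.Coprime q d := Nat.Coprime.coprime_dvd_right (Dvd.intro l rfl) hcop
  have hql : Nat.Coprime q l := Nat.Coprime.coprime_dvd_right (Dvd.intro_left d rfl) hcop
  have hq1 : (1 : ℕ) ≠ q := hq.one_lt.ne
  unfold xi1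
  have hfilt : q.divisors.filter (fun k => Nat.Coprime k l) = {1, q} := by
    rw [Finset.filter_true_of_mem, hq.divisors]
    intro k hk
    exact Nat.Coprime.coprime_dvd_left (Nat.dvd_of_mem_divisors hk) hql
  rw [hfilt, Finset.sum_pair hq1]
  have hκ1 : kappaTilde1 c' χ (q / 1) (d * 1) 1 = kappaTilde1 c' χ q 1 1 := by
    rw [Nat.div_one, mul_one]
    unfold kappaTilde1
    refine tsum_congr fun h => ?_
    have hiff : (h ∈ Skeleton.nset q ∧ Nat.Coprime h d) ↔ (h ∈ Skeleton.nset q ∧ Nat.Coprime h 1) := by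
      constructor
      · rintro ⟨hn, -⟩
        exact ⟨hn, Nat.coprime_one_right h⟩
      · rintro ⟨hn, -⟩
        refine ⟨hn, Nat.coprime_of_dvd fun p hp hph hpd => ?_⟩
        have hpq : p = q := (Nat.prime_dvd_prime_iff_eq hp hq).mp (hn.2 p hp hph)
        subst hpq
        exact (Nat.Prime.coprime_iff_not_dvd hp).mp hqd hpd
    by_cases h1 : h ∈ Skeleton.nset q ∧ Nat.Coprime h d
    · rw [if_pos h1, if_pos (hiff.mp h1)]
    · rw [if_neg h1, if_neg (fun h2 => h1 (hiff.mpr h2))]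
  have hκq : kappaTilde1 c' χ (q / q) (d * q) 1 = 1 := by
    rw [Nat.div_self hq.pos]
    exact kappaTilde1_one c' χ (d * q)
  rw [hκ1, hκq, ArithmeticFunction.moebius_apply_one, ArithmeticFunction.moebius_apply_prime hq,
    Nat.totient_one, Nat.totient_prime hq, Nat.cast_sub hq.one_le]
  push_cast
  simp only [map_one]
  ring

/-- **(15.19) holds as soon as `ℳ₁(1,1;1−β_j) ≠ 0`** (the division in `ϖ_{1j}` then cancels): an edge
for the dischargers, who obtain the non-vanishing from Lemma 15.2. [cite: Zhang2022LandauSiegel, §15 (15.19) p. 85] -/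
theorem eq15_19_of_ne_zero (b : CoefFam)
    (h : Skeleton.ForAllLarge fun D _ χ => Skeleton.AssumptionA D χ →
      ∀ j ∈ ({1, 2, 3} : Finset ℕ), calM1 c' χ 1 1 (1 - Skeleton.betaJ c' D j) ≠ 0) :
    Eq15_19 c' b := by
  refine h.mono fun D _ χ _ _ hD hA j hj => ?_
  have hM := hD hA j hj
  unfold calS1 varpi1
  rw [Finset.mul_sum]
  refine Finset.sum_congr rfl fun n _ => ?_
  rw [Finset.mul_sum, Finset.mul_sum, Finset.sum_div, Finset.mul_sum]
  refine Finset.sum_congr rfl fun x _ => ?_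
  field_simp

end Edges

/-! ## Kernel discharge of §15.u031 (the local computation of `ξ₁(q;d,l)` at a prime) -/

section StepU031

variable (c' : ℝ)

/-- `𝒩(q) = {qⁱ : i ≥ 0}` for a prime `q`. [cite: Zhang2022LandauSiegel, §7 p. 13] -/
theorem mem_nset_prime_iff {q : ℕ} (hq : q.Prime) {h : ℕ} :
    h ∈ Skeleton.nset q ↔ ∃ i : ℕ, h = q ^ i := by
  constructor
  · rintro ⟨hpos, hh⟩
    exact ⟨_, Nat.eq_prime_pow_of_unique_prime_dvd hpos.ne'
      (fun {p} hp hph => (Nat.prime_dvd_prime_iff_eq hp hq).mp (hh p hp hph))⟩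
  · rintro ⟨i, rfl⟩
    exact ⟨pow_pos hq.pos i, fun p hp hpi => hp.dvd_of_dvd_pow hpi⟩

/-- `β₁ = b₁·i`. [cite: Zhang2022LandauSiegel, §2 (2.13)] -/
theorem beta1_eq_b1_mul_I (D : ℕ) : Skeleton.beta1 c' D = (Skeleton.b1 c' D : ℂ) * I := by
  unfold Skeleton.beta1 Skeleton.b1; push_cast; ring

/-- `β₂ = b₂·i`. [cite: Zhang2022LandauSiegel, §2 (2.13)] -/
theorem beta2_eq_b2_mul_I (D : ℕ) : Skeleton.beta2 c' D = (Skeleton.b2 c' D : ℂ) * I := by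
  unfold Skeleton.beta2 Skeleton.b2; push_cast; ring

/-- `κ₁(q) = q^{−β₁} + q^{−β₂} − 1` at a prime `q` (the tree's `MeanSquareMajorant.kappa₁_apply_prime`).
[cite: Zhang2022LandauSiegel, §15 p. 84] -/
theorem kappa1_prime {D : ℕ} {q : ℕ} (hq : q.Prime) :
    kappa1 c' D q = (q : ℂ) ^ (-Skeleton.beta1 c' D) + (q : ℂ) ^ (-Skeleton.beta2 c' D) - 1 := by
  unfold kappa1
  rw [MeanSquareMajorant.kappa₁_apply_prime _ _ hq,
    MeanSquareMajorant.powI_apply_of_ne_zero _ hq.ne_zero,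
    MeanSquareMajorant.powI_apply_of_ne_zero _ hq.ne_zero, beta1_eq_b1_mul_I, beta2_eq_b2_mul_I]

/-- `κ̃₁(q;1,1) = Σ_{i≥0} κ₁(q^{i+1})χ(qⁱ)q^{−i}` (the series over `𝒩(q) = {qⁱ}`).
[cite: Zhang2022LandauSiegel, §15 p. 84] -/
theorem kappaTilde1_prime_eq_tsum {D : ℕ} (χ : DirichletCharacter ℂ D) {q : ℕ} (hq : q.Prime) :
    kappaTilde1 c' χ q 1 1 =
      ∑' i : ℕ, kappa1 c' D (q ^ (i + 1)) * χ ((q ^ i : ℕ) : ZMod D) / ((q ^ i : ℕ) : ℂ) := by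
  classical
  unfold kappaTilde1
  have hinj : Function.Injective (fun i : ℕ => q ^ i) := Nat.pow_right_injective hq.two_le
  have hsupp : Function.support (fun h : ℕ => if h ∈ Skeleton.nset q ∧ Nat.Coprime h 1 then
      kappa1 c' D (q * h) * χ (h : ZMod D) / (h : ℂ) ^ (1 : ℂ) else 0) ⊆
      Set.range (fun i : ℕ => q ^ i) := by
    intro h hh
    rw [Function.mem_support] at hh
    by_contra hrange
    apply hh
    rw [if_neg]
    rintro ⟨hmem, -⟩
    obtain ⟨i, rfl⟩ := (mem_nset_prime_iff hq).mp hmem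
    exact hrange ⟨i, rfl⟩
  rw [← hinj.tsum_eq hsupp]
  refine tsum_congr fun i => ?_
  have hmem : q ^ i ∈ Skeleton.nset q ∧ Nat.Coprime (q ^ i) 1 :=
    ⟨(mem_nset_prime_iff hq).mpr ⟨i, rfl⟩, Nat.coprime_one_right _⟩
  show (if q ^ i ∈ Skeleton.nset q ∧ Nat.Coprime (q ^ i) 1 then
      kappa1 c' D (q * q ^ i) * χ ((q ^ i : ℕ) : ZMod D) / ((q ^ i : ℕ) : ℂ) ^ (1 : ℂ) else 0) = _
  rw [if_pos hmem, ← pow_succ', cpow_one]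

/-- `|κ₁(q^{i+1})χ(qⁱ)q^{−i}| ≤ (i+2)²q^{−i}`. [cite: Zhang2022LandauSiegel, §15 p. 84] -/
theorem norm_term_le {D : ℕ} (χ : DirichletCharacter ℂ D) {q : ℕ} (hq : q.Prime) (i : ℕ) :
    ‖kappa1 c' D (q ^ (i + 1)) * χ ((q ^ i : ℕ) : ZMod D) / ((q ^ i : ℕ) : ℂ)‖ ≤
      ((i : ℝ) + 2) ^ 2 / (q : ℝ) ^ i := by
  have hk : ‖kappa1 c' D (q ^ (i + 1))‖ ≤ ((i : ℝ) + 2) ^ 2 := by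
    have := MeanSquareMajorant.norm_kappa₁_prime_pow_le (Skeleton.b1 c' D) (Skeleton.b2 c' D) hq (i + 1)
    unfold kappa1
    calc ‖MeanSquareMajorant.kappa₁ (Skeleton.b1 c' D) (Skeleton.b2 c' D) (q ^ (i + 1))‖
        ≤ (((i + 1 : ℕ) : ℝ) + 1) ^ 2 := this
      _ = ((i : ℝ) + 2) ^ 2 := by push_cast; ring
  have hχ : ‖χ ((q ^ i : ℕ) : ZMod D)‖ ≤ 1 := DirichletCharacter.norm_le_one χ _
  have hqi : (0 : ℝ) < (q : ℝ) ^ i := pow_pos (by exact_mod_cast hq.pos) i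
  have hn : ‖((q ^ i : ℕ) : ℂ)‖ = (q : ℝ) ^ i := by rw [Complex.norm_natCast, Nat.cast_pow]
  rw [norm_div, norm_mul, hn, div_le_div_iff_of_pos_right hqi]
  calc ‖kappa1 c' D (q ^ (i + 1))‖ * ‖χ ((q ^ i : ℕ) : ZMod D)‖
      ≤ ((i : ℝ) + 2) ^ 2 * 1 := by gcongr
    _ = ((i : ℝ) + 2) ^ 2 := mul_one _

/-- The majorant `(i+k)²·2^{−i}` is summable. [folklore] -/
private theorem summable_sq_shift_geometric (k : ℕ) :
    Summable (fun i : ℕ => ((i : ℝ) + k) ^ 2 * (1 / 2 : ℝ) ^ i) := by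
  have h : Summable (fun n : ℕ => (n : ℝ) ^ 2 * (1 / 2 : ℝ) ^ n) :=
    summable_pow_mul_geometric_of_norm_lt_one 2 (by norm_num)
  have h2 : Summable (fun n : ℕ => (((n + k : ℕ) : ℝ)) ^ 2 * (1 / 2 : ℝ) ^ (n + k)) :=
    (summable_nat_add_iff k).mpr h
  refine (h2.mul_left ((2 : ℝ) ^ k)).congr fun n => ?_
  push_cast
  rw [pow_add]
  have : (2 : ℝ) ^ k * (1 / 2 : ℝ) ^ k = 1 := by rw [← mul_pow]; norm_num
  calc (2 : ℝ) ^ k * (((n : ℝ) + k) ^ 2 * ((1 / 2 : ℝ) ^ n * (1 / 2 : ℝ) ^ k))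
      = ((n : ℝ) + k) ^ 2 * (1 / 2 : ℝ) ^ n * ((2 : ℝ) ^ k * (1 / 2 : ℝ) ^ k) := by ring
    _ = ((n : ℝ) + k) ^ 2 * (1 / 2 : ℝ) ^ n := by rw [this, mul_one]

/-- **§15.u031 holds** (both halves): for a prime `q` with `(q,dl) = 1`,
`ξ₁(q;d,l) = Σ_{h∈𝒩(q)} κ₁(qh)χ(h)h⁻¹ − χ(q)q/(q−1)` and
`|ξ₁(q;d,l) − (q^{−β₁} + q^{−β₂} − 1 − χ(q))| ≤ C/q` with the absolute constant
`C = Σ_{i≥0}(i+3)²2^{−i} + 2` (from `|κ₁(q^k)| ≤ (k+1)²`, `|χ| ≤ 1`).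
[cite: Zhang2022LandauSiegel, §15 p. 84] -/
theorem step15_u031_holds : Step15_u031 c' := by
  classical
  refine ⟨(∑' i : ℕ, ((i : ℝ) + (3 : ℕ)) ^ 2 * (1 / 2 : ℝ) ^ i) + 2, ?_⟩
  refine Skeleton.ForAllLarge.of_le 0 fun D _ χ _ _ _ => ?_
  intro _ q d l hq _ _ hcop
  refine ⟨xi1_prime_eq c' χ hq hcop, ?_⟩
  -- notation
  set C₀ : ℝ := ∑' i : ℕ, ((i : ℝ) + (3 : ℕ)) ^ 2 * (1 / 2 : ℝ) ^ i with hC₀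
  set f : ℕ → ℂ := fun i => kappa1 c' D (q ^ (i + 1)) * χ ((q ^ i : ℕ) : ZMod D) /
    ((q ^ i : ℕ) : ℂ) with hf
  have hq2 : (2 : ℝ) ≤ q := by exact_mod_cast hq.two_le
  have hq0 : (0 : ℝ) < q := by linarith
  -- summability of `f` and of its tail majorant
  have hG := summable_sq_shift_geometric 2
  have hG3 := summable_sq_shift_geometric 3
  have hfnorm : ∀ i, ‖f i‖ ≤ ((i : ℝ) + (2 : ℕ)) ^ 2 * (1 / 2 : ℝ) ^ i := by
    intro i
    refine (norm_term_le c' χ hq i).trans ?_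
    rw [div_eq_mul_inv, ← inv_pow, Nat.cast_ofNat]
    gcongr
    · rw [one_div]
      exact inv_anti₀ (by norm_num) hq2
  have hfs : Summable f := Summable.of_norm_bounded hG hfnorm
  -- split off `i = 0`
  have hsplit : ∑' i, f i = f 0 + ∑' i, f (i + 1) := hfs.tsum_eq_zero_add
  have hf0 : f 0 = (q : ℂ) ^ (-Skeleton.beta1 c' D) + (q : ℂ) ^ (-Skeleton.beta2 c' D) - 1 := by
    simp only [hf, pow_zero, pow_one, Nat.cast_one, map_one, mul_one, div_one, zero_add]
    exact kappa1_prime c' hq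
  -- the tail bound
  have htail_norm : ∀ i, ‖f (i + 1)‖ ≤ (1 / (q : ℝ)) * (((i : ℝ) + (3 : ℕ)) ^ 2 * (1 / 2 : ℝ) ^ i) := by
    intro i
    refine (norm_term_le c' χ hq (i + 1)).trans ?_
    have hqne : (q : ℝ) ≠ 0 := hq0.ne'
    have e : ((((i + 1 : ℕ) : ℝ)) + 2) ^ 2 / (q : ℝ) ^ (i + 1) =
        (1 / (q : ℝ)) * (((i : ℝ) + (3 : ℕ)) ^ 2 * ((q : ℝ) ^ i)⁻¹) := by
      push_cast
      field_simp
      ring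
    have h1 : ((q : ℝ) ^ i)⁻¹ ≤ (1 / 2 : ℝ) ^ i := by
      rw [← inv_pow, one_div]
      exact pow_le_pow_left₀ (by positivity) (inv_anti₀ (by norm_num) hq2) i
    rw [e]
    gcongr
  have htail_s : Summable (fun i => f (i + 1)) := (summable_nat_add_iff 1).mpr hfs
  have htail : ‖∑' i, f (i + 1)‖ ≤ (1 / (q : ℝ)) * C₀ := by
    calc ‖∑' i, f (i + 1)‖ ≤ ∑' i, ‖f (i + 1)‖ := norm_tsum_le_tsum_norm htail_s.norm
      _ ≤ ∑' i : ℕ, (1 / (q : ℝ)) * (((i : ℝ) + (3 : ℕ)) ^ 2 * (1 / 2 : ℝ) ^ i) :=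
          hasSum_le htail_norm htail_s.norm.hasSum (hG3.mul_left _).hasSum
      _ = (1 / (q : ℝ)) * C₀ := by rw [tsum_mul_left]
  -- the `χ(q)/(q-1)` term
  have hq1 : ((q : ℂ) - 1) ≠ 0 := by
    have : (1 : ℝ) < q := by linarith
    intro h
    have h' : (q : ℂ) = 1 := sub_eq_zero.mp h
    have : (q : ℝ) = 1 := by exact_mod_cast (by exact_mod_cast h' : (q : ℂ) = 1)
    linarith
  have hχq : ‖χ (q : ZMod D) / ((q : ℂ) - 1)‖ ≤ 2 / (q : ℝ) := by
    rw [norm_div]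
    have hden : ‖(q : ℂ) - 1‖ = (q : ℝ) - 1 := by
      have : (q : ℂ) - 1 = (((q : ℝ) - 1 : ℝ) : ℂ) := by push_cast; ring
      rw [this, Complex.norm_real, Real.norm_eq_abs, abs_of_nonneg (by linarith)]
    rw [hden]
    have hpos : (0 : ℝ) < (q : ℝ) - 1 := by linarith
    calc ‖χ (q : ZMod D)‖ / ((q : ℝ) - 1) ≤ 1 / ((q : ℝ) - 1) := by
          gcongr; exact DirichletCharacter.norm_le_one χ _
      _ ≤ 2 / (q : ℝ) := by
          rw [div_le_div_iff₀ hpos hq0]; linarith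
  -- assemble
  have key : xi1 c' χ q d l - ((q : ℂ) ^ (-Skeleton.beta1 c' D) + (q : ℂ) ^ (-Skeleton.beta2 c' D)
      - 1 - χ (q : ZMod D)) = (∑' i, f (i + 1)) - χ (q : ZMod D) / ((q : ℂ) - 1) := by
    rw [xi1_prime_eq c' χ hq hcop, kappaTilde1_prime_eq_tsum c' χ hq]
    change (∑' i, f i) - _ - _ = _
    rw [hsplit, hf0]
    field_simp
    ring
  rw [key]
  calc ‖(∑' i, f (i + 1)) - χ (q : ZMod D) / ((q : ℂ) - 1)‖
      ≤ ‖∑' i, f (i + 1)‖ + ‖χ (q : ZMod D) / ((q : ℂ) - 1)‖ := norm_sub_le _ _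
    _ ≤ (1 / (q : ℝ)) * C₀ + 2 / (q : ℝ) := add_le_add htail hχq
    _ = (C₀ + 2) / (q : ℝ) := by rw [one_div_mul_eq_div, ← add_div]

/-- `Step15_u031` — `_holds` alias of `step15_u031_holds` above under the fact's exact name (appended
2026-08-28, D-0026 bookkeeping: the proof term is the existing theorem of this file; no statement,
definition or attribute is edited; no new named fact; the ledger's debt table listed the fact
unproved). [cite: Zhang2022LandauSiegel, §15 p. 84] -/
theorem _root_.Literature.NumberTheory.LFunctions.Zhang2022.Typed.Section15B.Step15_u031_holds :
    Step15_u031 c' :=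
  _root_.Literature.NumberTheory.LFunctions.Zhang2022.Typed.Section15B.step15_u031_holds (c' := c')

end StepU031

/-! ## Kernel discharge of §15.u029 (the Mellin representation of `y^{β₃}g(P₄/y)`) -/

section StepU029

variable (c' : ℝ)

/-- `β₃ = b₃·i`. [cite: Zhang2022LandauSiegel, §2 (2.13)] -/
theorem beta3_eq_b3_mul_I (D : ℕ) : Skeleton.beta3 c' D = (Skeleton.b3 c' D : ℂ) * I := by
  unfold Skeleton.beta3 Skeleton.b3; push_cast; ring

/-- **§15.u029 holds**: `y^{β₃}g(P₄/y) = (1/2πi)∫_{(1)} P₄^{s+β₃}y^{−s}ω₁(s+β₃)(s+β₃)⁻¹ds` for `y > 0`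
(and `D ≥ 2`): substitute `w = s + β₃` (a translation of the line `Re s = 1`, `β₃ ∈ iℝ`), factor
`P₄^{w}y^{β₃−w} = y^{β₃}(P₄/y)^{w}`, and apply the tree's Mellin representation of `g`
(`GaussWeight.gWeight_eq_verticalIntegral`, (4.1)). [cite: Zhang2022LandauSiegel, §15 p. 84] -/
theorem step15_u029_holds : Step15_u029 c' := by
  refine Skeleton.ForAllLarge.of_le 2 fun D _ χ hD _ _ => ?_
  intro y hy
  have hD1 : (1 : ℝ) < D := by exact_mod_cast hD
  have hℓ : 0 < Skeleton.ell D := Real.log_pos hD1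
  have hΛ : 0 < Skeleton.ell D ^ 30 := pow_pos hℓ 30
  have hP4 : 0 < Skeleton.P4 D := by
    unfold Skeleton.P4 Skeleton.bigP Skeleton.bigT Skeleton.t0
    exact mul_pos (div_pos (Real.exp_pos _) (pow_pos (Real.exp_pos _) 2)) (pow_pos hℓ 519)
  set b : ℝ := Skeleton.b3 c' D with hb
  set Λ : ℝ := Skeleton.ell D ^ 30 with hΛdef
  set x : ℝ := Skeleton.P4 D / y with hx
  have hx0 : 0 < x := div_pos hP4 hy
  have hβ : Skeleton.beta3 c' D = (b : ℂ) * I := beta3_eq_b3_mul_I c' D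
  have hy0 : (y : ℂ) ≠ 0 := by exact_mod_cast hy.ne'
  set K : ℝ → ℂ := fun u => (x : ℂ) ^ (((1 : ℝ) : ℂ) + (u : ℂ) * I) *
    GaussWeight.omega1 Λ (((1 : ℝ) : ℂ) + (u : ℂ) * I) / (((1 : ℝ) : ℂ) + (u : ℂ) * I) with hK
  -- the pointwise identity of integrands
  have hpt : ∀ t : ℝ,
      (Skeleton.P4 D : ℂ) ^ (1 + t * I + Skeleton.beta3 c' D) / (y : ℂ) ^ (1 + t * I) *
        (GaussWeight.omega1 Λ (1 + t * I + Skeleton.beta3 c' D) /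
          (1 + t * I + Skeleton.beta3 c' D)) =
      (y : ℂ) ^ Skeleton.beta3 c' D * K (t + b) := by
    intro t
    have hw : (1 : ℂ) + t * I + Skeleton.beta3 c' D = ((1 : ℝ) : ℂ) + (((t + b : ℝ)) : ℂ) * I := by
      rw [hβ]; push_cast; ring
    rw [hw]
    simp only [hK]
    set w : ℂ := ((1 : ℝ) : ℂ) + (((t + b : ℝ)) : ℂ) * I with hwdef
    have hxw : (x : ℂ) ^ w = (Skeleton.P4 D : ℂ) ^ w * ((y : ℂ) ^ w)⁻¹ := by
      rw [hx, div_eq_mul_inv, Complex.ofReal_mul, Complex.mul_cpow_ofReal_nonneg hP4.le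
        (inv_nonneg.mpr hy.le), Complex.ofReal_inv,
        Complex.inv_cpow _ _ (by rw [Complex.arg_ofReal_of_nonneg hy.le]; exact Real.pi_ne_zero.symm)]
    have hyw : (y : ℂ) ^ Skeleton.beta3 c' D * ((y : ℂ) ^ w)⁻¹ = ((y : ℂ) ^ (1 + t * I))⁻¹ := by
      rw [← cpow_neg, ← cpow_neg, ← cpow_add _ _ hy0]
      congr 1
      rw [hwdef, hβ]; push_cast; ring
    rw [hxw, div_eq_mul_inv ((Skeleton.P4 D : ℂ) ^ w), ← hyw]
    ring
  simp_rw [hpt]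
  rw [integral_const_mul]
  have htrans : ∫ t : ℝ, K (t + b) = ∫ t : ℝ, K t := integral_add_right_eq_self K b
  rw [htrans]
  have hg : (1 / (2 * π) : ℂ) * ∫ t : ℝ, K t = (GaussWeight.gWeight Λ x : ℂ) :=
    GaussWeight.gWeight_eq_verticalIntegral hΛ one_pos hx0
  unfold Skeleton.gW
  rw [← hg]
  ring

/-- `Step15_u029` — `_holds` alias of `step15_u029_holds` above under the fact's exact name (appended
2026-08-28, D-0026 bookkeeping: the proof term is the existing theorem of this file; no statement,
definition or attribute is edited; no new named fact; the ledger's debt table listed the fact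
unproved). [cite: Zhang2022LandauSiegel, §15 p. 84] -/
theorem _root_.Literature.NumberTheory.LFunctions.Zhang2022.Typed.Section15B.Step15_u029_holds :
    Step15_u029 c' :=
  _root_.Literature.NumberTheory.LFunctions.Zhang2022.Typed.Section15B.step15_u029_holds (c' := c')

end StepU029

/-! ## Kernel edges between the displayed claims: §15.u036 ⇐ (15.14) + u034, (15.21) ⇐ u040 -/

section StepU036

variable (c' : ℝ)

/-- Every `β_j` is purely imaginary. [cite: Zhang2022LandauSiegel, §2 (2.13)] -/
theorem betaJ_re (D j : ℕ) : (Skeleton.betaJ c' D j).re = 0 := by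
  unfold Skeleton.betaJ
  split_ifs <;> simp [beta1_eq_b1_mul_I, beta2_eq_b2_mul_I, beta3_eq_b3_mul_I]

/-- On the line `s = 1 + it` the integrands of (15.14) and of §15.u036 agree, given the defining
identity `ℳ₁ = calM1Series` on `σ > 1` (u034): the factors `ζ(2+it)`, `L(2+it,χ)`, `ζ(2+it+β₁)`,
`ζ(2+it+β₂)` are all non-zero (`Re = 2 > 1`). [cite: Zhang2022LandauSiegel, §15 p. 85] -/
theorem integrandU036_eq_integrand1514 (h34 : Step15_u034 c') {D : ℕ} [NeZero D]
    (χ : DirichletCharacter ℂ D) {d l : ℕ} (hd : 1 ≤ d) (hl : 1 ≤ l) (t : ℝ) :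
    integrandU036 c' χ d l (1 + t * I) = integrand1514 c' χ d l (1 + t * I) := by
  have hre : 1 < (1 + (1 + (t : ℂ) * I)).re := by simp
  have hM := h34 D χ d l hd hl (1 + (1 + t * I)) hre
  have hz : riemannZeta (1 + (1 + t * I)) ≠ 0 := riemannZeta_ne_zero_of_one_lt_re hre
  have hL : χ.LFunction (1 + (1 + t * I)) ≠ 0 :=
    DirichletCharacter.LFunction_ne_zero_of_one_le_re χ (Or.inr (by
      intro h; have := congrArg Complex.re h; simp at this)) hre.le
  have hz1 : riemannZeta (1 + (1 + t * I) + Skeleton.beta1 c' D) ≠ 0 := by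
    apply riemannZeta_ne_zero_of_one_lt_re
    simp [beta1_eq_b1_mul_I]
  have hz2 : riemannZeta (1 + (1 + t * I) + Skeleton.beta2 c' D) ≠ 0 := by
    apply riemannZeta_ne_zero_of_one_lt_re
    simp [beta2_eq_b2_mul_I]
  unfold integrandU036 integrand1514
  rw [hM]
  unfold calM1Series
  congr 1
  congr 1
  field_simp

/-- **§15.u036 ⇐ (15.14) + u034** (edge): rewriting the integrand of (15.14) through the defining
identity of `ℳ₁` on `σ > 1` changes nothing on the line `Re(1+s) = 2`, so (15.14) and the display
§15.u036 are the same estimate (same `c`, same implied constant).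
[cite: Zhang2022LandauSiegel, §15 p. 85] -/
theorem step15_u036_of_eq15_14 (h14 : Eq15_14 c') (h34 : Step15_u034 c') : Step15_u036 c' := by
  obtain ⟨c, hc, C, hS⟩ := h14
  refine ⟨c, hc, C, hS.mono fun D _ χ _ _ h hA d l hd hl => ?_⟩
  have hint : (∫ t : ℝ, integrandU036 c' χ d l (1 + t * I)) =
      ∫ t : ℝ, integrand1514 c' χ d l (1 + t * I) := by
    congr 1
    funext t
    exact integrandU036_eq_integrand1514 c' h34 χ hd hl t
  rw [hint]
  exact h hA d l hd hl

end StepU036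

section Eq1521

variable (c' : ℝ)

/-- `‖d^{β_j}‖ = 1` for `d ≥ 1` (`β_j ∈ iℝ`). [cite: Zhang2022LandauSiegel, §2 (2.13)] -/
theorem norm_natCast_cpow_betaJ (D j : ℕ) {d : ℕ} (hd : 1 ≤ d) :
    ‖(d : ℂ) ^ Skeleton.betaJ c' D j‖ = 1 := by
  have hd0 : (0 : ℝ) < d := by exact_mod_cast hd
  rw [show (d : ℂ) = ((d : ℝ) : ℂ) by simp, Complex.norm_cpow_eq_rpow_re_of_pos hd0, betaJ_re,
    Real.rpow_zero]

/-- If `(n, 𝒬) = 1` and `D ≥ 2` then `(n, D) = 1`: every prime factor of `D` is `< D⁴`, hence divides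
`𝒬 = ∏_{q<D⁴} q`. [cite: Zhang2022LandauSiegel, §15 p. 86] -/
theorem coprime_of_coprime_frakq {D n : ℕ} (hD : 2 ≤ D) (hn : Nat.Coprime n (Skeleton.frakq D)) :
    Nat.Coprime n D := by
  apply Nat.Coprime.symm
  apply Nat.coprime_of_dvd
  intro p hp hpD hpn
  have hpq : p ∣ Skeleton.frakq D := by
    unfold Skeleton.frakq
    apply Finset.dvd_prod_of_mem
    simp only [Finset.mem_filter, Finset.mem_range]
    refine ⟨?_, hp⟩
    have hple : p ≤ D := Nat.le_of_dvd (by omega) hpD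
    calc p ≤ D := hple
      _ < D ^ 4 := by
        calc D = D ^ 1 := (pow_one D).symm
          _ < D ^ 4 := Nat.pow_lt_pow_right (by omega) (by norm_num)
  have := Nat.dvd_gcd hpn hpq
  rw [hn] at this
  exact hp.one_lt.ne' (Nat.dvd_one.mp this)

/-- For a quadratic character and `(d, D) = 1`: `χ(d)² = 1`. [cite: Zhang2022LandauSiegel, §2 p. 4] -/
theorem mul_self_eq_one_of_isQuadratic {D : ℕ} (χ : DirichletCharacter ℂ D) (hq : χ.IsQuadratic)
    {d : ℕ} (hd : Nat.Coprime d D) : χ (d : ZMod D) * χ (d : ZMod D) = 1 := by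
  have hu : IsUnit (d : ZMod D) := (ZMod.isUnit_iff_coprime d D).mpr hd
  rcases hq (d : ZMod D) with h0 | h1 | h1
  · exact absurd h0 (hu.map χ).ne_zero
  · rw [h1]; norm_num
  · rw [h1]; norm_num

/-- `χ(n)ϱ*_j(n) = Σ_{n=dl} d^{β_j}χ(l)` for quadratic `χ` and `(n,D) = 1`.
[cite: Zhang2022LandauSiegel, §15 (15.21) p. 86] -/
theorem chi_mul_varrhoStar_eq {D : ℕ} (χ : DirichletCharacter ℂ D) (hq : χ.IsQuadratic) (j : ℕ)
    {n : ℕ} (hn : Nat.Coprime n D) :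
    χ (n : ZMod D) * Skeleton.varrhoStar c' χ j n =
      ∑ x ∈ n.divisorsAntidiagonal, (x.1 : ℂ) ^ Skeleton.betaJ c' D j * χ (x.2 : ZMod D) := by
  unfold Skeleton.varrhoStar
  rw [Finset.mul_sum, Nat.sum_divisorsAntidiagonal fun a b => (a : ℂ) ^ Skeleton.betaJ c' D j * χ (b : ZMod D)]
  apply Finset.sum_congr rfl
  intro d hd
  have hdn : d ∣ n := Nat.dvd_of_mem_divisors hd
  obtain ⟨l, rfl⟩ := hdn
  have hd0 : 0 < d := Nat.pos_of_mem_divisors hd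
  rw [Nat.mul_div_cancel_left l hd0]
  have hdD : Nat.Coprime d D := Nat.Coprime.coprime_dvd_left (Dvd.intro l rfl) hn
  have h2 := mul_self_eq_one_of_isQuadratic χ hq hdD
  push_cast
  rw [map_mul]
  linear_combination ((d : ℂ) ^ Skeleton.betaJ c' D j * χ (l : ZMod D)) * h2

/-- **(15.21) ⇐ §15.u040** (edge): `ϖ_{1j}(n) − χ(n)ϱ*_j(n) = Σ_{n=dl} d^{β_j}χ(l)(λ₁(d)ℳ₁(d,l;1−β_j)
/ℳ₁(1,1;1−β_j) − 1)`, each term of norm `≤ C D^{−c}` by u040 (`|d^{β_j}| = 1`, `|χ(l)| ≤ 1`), and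
there are `τ₂(n)` terms; `χ(n)χ(d) = χ(l)` because `χ` is real and `(n,D) = 1` (as `(n,𝒬) = 1`).
[cite: Zhang2022LandauSiegel, §15 (15.21) p. 86] -/
theorem eq15_21_of_step15_u040 (h40 : Step15_u040 c') : Eq15_21 c' := by
  obtain ⟨c, hc, C, D₀, hS⟩ := h40
  refine ⟨c, hc, max C 0, max D₀ 2, fun D _ χ hD hq hp hA j hj n hn hnP hnq => ?_⟩
  have hD₀ : D₀ ≤ D := le_trans (le_max_left _ _) hD
  have hD2 : 2 ≤ D := le_trans (le_max_right _ _) hD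
  have hnD : Nat.Coprime n D := coprime_of_coprime_frakq hD2 hnq
  have h40' := hS D χ hD₀ hq hp hA j hj
  rw [chi_mul_varrhoStar_eq c' χ hq j hnD]
  unfold varpi1
  rw [← Finset.sum_sub_distrib]
  have hterm : ∀ x ∈ n.divisorsAntidiagonal,
      ‖lam1 c' χ x.1 1 * (x.1 : ℂ) ^ Skeleton.betaJ c' D j * χ (x.2 : ZMod D) *
            (calM1 c' χ x.1 x.2 (1 - Skeleton.betaJ c' D j) /
              calM1 c' χ 1 1 (1 - Skeleton.betaJ c' D j)) -
          (x.1 : ℂ) ^ Skeleton.betaJ c' D j * χ (x.2 : ZMod D)‖ ≤ max C 0 * (D : ℝ) ^ (-c) := by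
    intro x hx
    have hx' := Nat.mem_divisorsAntidiagonal.mp hx
    have hd1 : 1 ≤ x.1 := Nat.pos_of_ne_zero (fun h => by
      have := hx'.1; rw [h, zero_mul] at this; exact hx'.2 this.symm)
    have e : lam1 c' χ x.1 1 * (x.1 : ℂ) ^ Skeleton.betaJ c' D j * χ (x.2 : ZMod D) *
            (calM1 c' χ x.1 x.2 (1 - Skeleton.betaJ c' D j) /
              calM1 c' χ 1 1 (1 - Skeleton.betaJ c' D j)) -
          (x.1 : ℂ) ^ Skeleton.betaJ c' D j * χ (x.2 : ZMod D) =
        ((x.1 : ℂ) ^ Skeleton.betaJ c' D j * χ (x.2 : ZMod D)) *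
          (lam1 c' χ x.1 1 * calM1 c' χ x.1 x.2 (1 - Skeleton.betaJ c' D j) /
              calM1 c' χ 1 1 (1 - Skeleton.betaJ c' D j) - 1) := by ring
    rw [e, norm_mul, norm_mul, norm_natCast_cpow_betaJ c' D j hd1, one_mul]
    have hχ : ‖χ (x.2 : ZMod D)‖ ≤ 1 := DirichletCharacter.norm_le_one χ _
    have hu := h40' n x.1 x.2 hn hx'.1 hnP hnq
    have hC : C * (D : ℝ) ^ (-c) ≤ max C 0 * (D : ℝ) ^ (-c) :=
      mul_le_mul_of_nonneg_right (le_max_left _ _) (Real.rpow_nonneg (Nat.cast_nonneg _) _)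
    calc ‖χ (x.2 : ZMod D)‖ * ‖lam1 c' χ x.1 1 * calM1 c' χ x.1 x.2 (1 - Skeleton.betaJ c' D j) /
              calM1 c' χ 1 1 (1 - Skeleton.betaJ c' D j) - 1‖
        ≤ 1 * (max C 0 * (D : ℝ) ^ (-c)) :=
          mul_le_mul hχ (hu.trans hC) (norm_nonneg _) zero_le_one
      _ = max C 0 * (D : ℝ) ^ (-c) := one_mul _
  calc ‖∑ x ∈ n.divisorsAntidiagonal,
          (lam1 c' χ x.1 1 * (x.1 : ℂ) ^ Skeleton.betaJ c' D j * χ (x.2 : ZMod D) *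
              (calM1 c' χ x.1 x.2 (1 - Skeleton.betaJ c' D j) /
                calM1 c' χ 1 1 (1 - Skeleton.betaJ c' D j)) -
            (x.1 : ℂ) ^ Skeleton.betaJ c' D j * χ (x.2 : ZMod D))‖
      ≤ ∑ x ∈ n.divisorsAntidiagonal,
          ‖lam1 c' χ x.1 1 * (x.1 : ℂ) ^ Skeleton.betaJ c' D j * χ (x.2 : ZMod D) *
              (calM1 c' χ x.1 x.2 (1 - Skeleton.betaJ c' D j) /
                calM1 c' χ 1 1 (1 - Skeleton.betaJ c' D j)) -
            (x.1 : ℂ) ^ Skeleton.betaJ c' D j * χ (x.2 : ZMod D)‖ := norm_sum_le _ _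
    _ ≤ ∑ x ∈ n.divisorsAntidiagonal, max C 0 * (D : ℝ) ^ (-c) := Finset.sum_le_sum hterm
    _ = (n.divisorsAntidiagonal.card : ℝ) * (max C 0 * (D : ℝ) ^ (-c)) := by
          rw [Finset.sum_const, nsmul_eq_mul]
    _ = max C 0 * (n.divisors.card : ℝ) * (D : ℝ) ^ (-c) := by
          rw [← Nat.map_div_right_divisors, Finset.card_map]; ring

end Eq1521

/-! ## Kernel edges: (15.20) ⇐ multiplicativity of `ϖ_{1j}`; `ℳ₁(1,1) ≠ 0`, (15.19), the
multiplicativity of `ϖ_{1j}` and (15.20) ⇐ (15.18) -/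

section Eq1520

variable (c' : ℝ)

/-- A `𝒬`-smooth number and a `𝒬`-rough number are coprime. [cite: Zhang2022LandauSiegel, §15 p. 86] -/
theorem coprime_of_mem_nset_of_coprime {K a b : ℕ} (ha : a ∈ Skeleton.nset K)
    (hb : Nat.Coprime b K) : Nat.Coprime a b := by
  apply Nat.coprime_of_dvd
  intro q hq hqa hqb
  have hqK : q ∣ K := ha.2 q hq hqa
  have := Nat.dvd_gcd hqb hqK
  rw [hb] at this
  exact hq.one_lt.ne' (Nat.dvd_one.mp this)

/-- A prime divides `𝒬 = ∏_{q<D⁴} q` iff it is `< D⁴`. [cite: Zhang2022LandauSiegel, §15 p. 86] -/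
theorem prime_dvd_frakq_iff {D q : ℕ} (hq : q.Prime) : q ∣ Skeleton.frakq D ↔ q < D ^ 4 := by
  unfold Skeleton.frakq
  rw [(Nat.Prime.prime hq).dvd_finsetProd_iff]
  constructor
  · rintro ⟨p, hp, hqp⟩
    rw [Finset.mem_filter, Finset.mem_range] at hp
    rw [(Nat.prime_dvd_prime_iff_eq hq hp.2).mp hqp]
    exact hp.1
  · intro h
    exact ⟨q, by simp [Finset.mem_filter, h, hq], dvd_rfl⟩

/-- **Existence of the factorisation `n = n₁n₂`, `n₁ ∈ 𝒩(𝒬)`, `(n₂,𝒬) = 1`** (p. 86, tex L4252: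
"Every `n` can be uniquely written as …"). [cite: Zhang2022LandauSiegel, §15 (15.20) p. 86] -/
theorem exists_smooth_mul_rough (D : ℕ) {m : ℕ} (hm : m ≠ 0) :
    ∃ n₁ n₂ : ℕ, n₁ * n₂ = m ∧ n₁ ∈ Skeleton.nset (Skeleton.frakq D) ∧
      Nat.Coprime n₂ (Skeleton.frakq D) := by
  classical
  refine ⟨∏ p ∈ m.primeFactors.filter (fun p => p < D ^ 4), p ^ m.factorization p,
    ∏ p ∈ m.primeFactors.filter (fun p => ¬ p < D ^ 4), p ^ m.factorization p, ?_, ?_, ?_⟩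
  · rw [Finset.prod_filter_mul_prod_filter_not]
    conv_rhs => rw [← Nat.prod_factorization_pow_eq_self hm]
    rw [Nat.prod_factorization_eq_prod_primeFactors]
  · refine ⟨Finset.prod_pos fun p hp => pow_pos (Nat.prime_of_mem_primeFactors
      (Finset.mem_filter.mp hp).1).pos _, fun q hq hqd => ?_⟩
    rw [(Nat.Prime.prime hq).dvd_finsetProd_iff] at hqd
    obtain ⟨p, hp, hqp⟩ := hqd
    rw [Finset.mem_filter] at hp
    have hpp : p.Prime := Nat.prime_of_mem_primeFactors hp.1
    have hqp' : q = p := (Nat.prime_dvd_prime_iff_eq hq hpp).mp (hq.dvd_of_dvd_pow hqp)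
    rw [prime_dvd_frakq_iff hq, hqp']
    exact hp.2
  · apply Nat.coprime_of_dvd
    intro q hq hqd hqK
    rw [(Nat.Prime.prime hq).dvd_finsetProd_iff] at hqd
    obtain ⟨p, hp, hqp⟩ := hqd
    rw [Finset.mem_filter] at hp
    have hpp : p.Prime := Nat.prime_of_mem_primeFactors hp.1
    have hqp' : q = p := (Nat.prime_dvd_prime_iff_eq hq hpp).mp (hq.dvd_of_dvd_pow hqp)
    rw [prime_dvd_frakq_iff hq, hqp'] at hqK
    exact hp.2 hqK

/-- **Uniqueness of the factorisation** `n = n₁n₂` (`n₁ ∈ 𝒩(𝒬)`, `(n₂,𝒬) = 1`).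
[cite: Zhang2022LandauSiegel, §15 (15.20) p. 86] -/
theorem smooth_mul_rough_unique {K n₁ n₂ n₁' n₂' : ℕ} (h : n₁ * n₂ = n₁' * n₂')
    (h₁ : n₁ ∈ Skeleton.nset K) (h₂ : Nat.Coprime n₂ K) (h₁' : n₁' ∈ Skeleton.nset K)
    (h₂' : Nat.Coprime n₂' K) : n₁ = n₁' ∧ n₂ = n₂' := by
  have ha : n₁ ∣ n₁' := by
    have : n₁ ∣ n₁' * n₂' := ⟨n₂, h.symm⟩
    exact (coprime_of_mem_nset_of_coprime h₁ h₂').dvd_of_dvd_mul_right this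
  have hb : n₁' ∣ n₁ := by
    have : n₁' ∣ n₁ * n₂ := ⟨n₂', h⟩
    exact (coprime_of_mem_nset_of_coprime h₁' h₂).dvd_of_dvd_mul_right this
  have he : n₁ = n₁' := Nat.dvd_antisymm ha hb
  refine ⟨he, ?_⟩
  subst he
  exact Nat.eq_of_mul_eq_mul_left h₁.1 h

open scoped Classical in
/-- **(15.20) ⇐ the multiplicativity of `ϖ_{1j}`** (edge), for any coefficient family supported below
`P`: the map `(n₁,n₂) ↦ n₁n₂` is a bijection from `{n₁ ∈ 𝒩(𝒬)} × {(n₂,𝒬) = 1}` onto the positive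
integers (`exists_smooth_mul_rough`, `smooth_mul_rough_unique`), `ϖ_{1j}(n₁n₂) = ϖ_{1j}(n₁)ϖ_{1j}(n₂)`
(`(n₁,n₂) = 1`), and the pairs with `n₁n₂ ≥ ⌈P⌉` contribute `b(n₁n₂) = 0`.
[cite: Zhang2022LandauSiegel, §15 (15.20) p. 86] -/
theorem eq15_20_of_varpiMult (b : CoefFam)
    (hb : Skeleton.ForAllLarge fun D _ χ => ∀ n : ℕ, Skeleton.bigP D ≤ n → b D χ n = 0)
    (hm : Inline15_varpiMult c') : Eq15_20 c' b := by
  refine (hb.and hm).mono fun D _ χ _ _ h hA j hj => ?_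
  obtain ⟨hb, hm⟩ := h
  have hmul := (hm hA j hj).2
  set N := ⌈Skeleton.bigP D⌉₊ with hN
  set K := Skeleton.frakq D with hK
  set S := (Finset.Ico 1 N).filter (fun n₁ => n₁ ∈ Skeleton.nset K) with hS
  set R := (Finset.Ico 1 N).filter (fun n => Nat.Coprime n K) with hR
  -- the right side as a sum over pairs
  have hrhs : ∑ n₁ ∈ S, varpi1 c' χ j n₁ / (n₁ : ℂ) *
        ∑ n ∈ R, b D χ (n₁ * n) * varpi1 c' χ j n / (n : ℂ) =
      ∑ x ∈ S ×ˢ R, varpi1 c' χ j x.1 / (x.1 : ℂ) *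
        (b D χ (x.1 * x.2) * varpi1 c' χ j x.2 / (x.2 : ℂ)) := by
    rw [Finset.sum_product]
    refine Finset.sum_congr rfl fun n₁ _ => ?_
    rw [Finset.mul_sum]
  rw [hrhs]
  -- drop the pairs with `n₁ n ≥ N` (there `b = 0`)
  have hsub : ∑ x ∈ (S ×ˢ R).filter (fun x => x.1 * x.2 < N),
        varpi1 c' χ j x.1 / (x.1 : ℂ) * (b D χ (x.1 * x.2) * varpi1 c' χ j x.2 / (x.2 : ℂ)) =
      ∑ x ∈ S ×ˢ R, varpi1 c' χ j x.1 / (x.1 : ℂ) *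
        (b D χ (x.1 * x.2) * varpi1 c' χ j x.2 / (x.2 : ℂ)) := by
    apply Finset.sum_subset (Finset.filter_subset _ _)
    intro x hx hxn
    rw [Finset.mem_filter, not_and] at hxn
    have hge : N ≤ x.1 * x.2 := not_lt.mp (hxn hx)
    have hP : Skeleton.bigP D ≤ ((x.1 * x.2 : ℕ) : ℝ) :=
      le_trans (Nat.le_ceil _) (by exact_mod_cast hge)
    rw [hb _ hP]
    simp
  rw [← hsub]
  symm
  -- the bijection `(n₁, n₂) ↦ n₁ n₂`
  refine Finset.sum_bij (fun x _ => x.1 * x.2) ?_ ?_ ?_ ?_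
  · intro x hx
    simp only [Finset.mem_filter, Finset.mem_product, hS, hR, Finset.mem_Ico] at hx
    rw [Finset.mem_Ico]
    exact ⟨Nat.one_le_iff_ne_zero.mpr (Nat.mul_ne_zero (by omega) (by omega)), hx.2⟩
  · intro x hx y hy hxy
    simp only [Finset.mem_filter, Finset.mem_product, hS, hR, Finset.mem_Ico] at hx hy
    obtain ⟨h1, h2⟩ := smooth_mul_rough_unique hxy hx.1.1.2 hx.1.2.2 hy.1.1.2 hy.1.2.2
    exact Prod.ext h1 h2
  · intro m hm
    rw [Finset.mem_Ico] at hm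
    obtain ⟨n₁, n₂, hprod, hn₁, hn₂⟩ := exists_smooth_mul_rough D (m := m) (by omega)
    have hn₁0 : n₁ ≠ 0 := fun h0 => by rw [h0, zero_mul] at hprod; omega
    have hn₂0 : n₂ ≠ 0 := fun h0 => by rw [h0, mul_zero] at hprod; omega
    have hn₁m : n₁ ≤ m := by rw [← hprod]; exact Nat.le_mul_of_pos_right _ (Nat.pos_of_ne_zero hn₂0)
    have hn₂m : n₂ ≤ m := by rw [← hprod]; exact Nat.le_mul_of_pos_left _ (Nat.pos_of_ne_zero hn₁0)
    refine ⟨(n₁, n₂), ?_, hprod⟩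
    simp only [Finset.mem_filter, Finset.mem_product, hS, hR, Finset.mem_Ico]
    exact ⟨⟨⟨⟨by omega, by omega⟩, hn₁⟩, ⟨by omega, by omega⟩, hn₂⟩, by omega⟩
  · intro x hx
    simp only [Finset.mem_filter, Finset.mem_product, hS, hR, Finset.mem_Ico] at hx
    have hcop : Nat.Coprime x.1 x.2 := coprime_of_mem_nset_of_coprime hx.1.1.2 hx.1.2.2
    have h1 : (x.1 : ℂ) ≠ 0 := by exact_mod_cast (show x.1 ≠ 0 by omega)
    have h2 : (x.2 : ℂ) ≠ 0 := by exact_mod_cast (show x.2 ≠ 0 by omega)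
    rw [hmul x.1 x.2 hcop]
    push_cast
    field_simp

/-- `P·T⁻²·η₊ < P` once `𝓛 ≥ 3` (`η₊ = exp{𝓛⁻¹⁰} < T² = exp{2𝓛^{1.1}}`).
[cite: Zhang2022LandauSiegel, §15 (15.2) p. 79] -/
theorem bigP_div_T_sq_mul_eta_lt_bigP {D : ℕ} (hD : 1 ≤ Skeleton.ell D) :
    Skeleton.bigP D / Skeleton.bigT D ^ 2 * Skeleton.etaPM D 1 < Skeleton.bigP D := by
  have hP : 0 < Skeleton.bigP D := by unfold Skeleton.bigP; positivity
  have hT : Skeleton.bigT D ^ 2 = Real.exp (2 * Skeleton.ell D ^ (1.1 : ℝ)) := by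
    unfold Skeleton.bigT; rw [← Real.exp_nat_mul]; norm_num
  rw [hT, Skeleton.etaPM, one_mul, div_mul_eq_mul_div, div_lt_iff₀ (Real.exp_pos _)]
  have h1 : (Skeleton.ell D ^ 10)⁻¹ ≤ 1 := by
    apply inv_le_one_of_one_le₀
    exact one_le_pow₀ hD
  have h2 : (1 : ℝ) ≤ Skeleton.ell D ^ (1.1 : ℝ) := Real.one_le_rpow hD (by norm_num)
  calc Skeleton.bigP D * Real.exp ((Skeleton.ell D ^ 10)⁻¹)
      < Skeleton.bigP D * Real.exp (2 * Skeleton.ell D ^ (1.1 : ℝ)) := by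
        apply mul_lt_mul_of_pos_left _ hP
        apply Real.exp_lt_exp.mpr
        linarith

/-- The printed coefficients vanish from `P` on (eventually), by (15.2) (`Section15A.eq15_2_holds`).
[cite: Zhang2022LandauSiegel, §15 (15.2) p. 79] -/
theorem bLit_eq_zero_of_bigP_le :
    Skeleton.ForAllLarge fun D _ χ => ∀ n : ℕ, Skeleton.bigP D ≤ n → bLit D χ n = 0 := by
  obtain ⟨C, D₀, hS⟩ := Section15A.eq15_2_holds
  refine ⟨max D₀ 3, fun D _ χ hD hq hp n hn => ?_⟩
  have hD₀ : D₀ ≤ D := le_trans (le_max_left _ _) hD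
  have hD3 : (3 : ℝ) ≤ D := by exact_mod_cast le_trans (le_max_right _ _) hD
  have hell : 1 ≤ Skeleton.ell D := by
    unfold Skeleton.ell
    rw [← Real.log_exp 1]
    apply Real.log_le_log (Real.exp_pos 1)
    have := Real.exp_one_lt_d9
    linarith
  have h2 := (hS D χ hD₀ hq hp).2 n (lt_of_lt_of_le (bigP_div_T_sq_mul_eta_lt_bigP hell) hn)
  simpa [bLit] using h2

/-- Likewise for the χ-absorbed coefficients `bChi = χ·b`. [cite: Zhang2022LandauSiegel, §15 (15.2) p. 79] -/
theorem bChi_eq_zero_of_bigP_le :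
    Skeleton.ForAllLarge fun D _ χ => ∀ n : ℕ, Skeleton.bigP D ≤ n → bChi D χ n = 0 := by
  refine bLit_eq_zero_of_bigP_le.mono fun D _ χ _ _ h n hn => ?_
  have := h n hn
  simp only [bLit] at this
  simp [bChi, bchi, this]

/-- **(15.20) for the printed coefficients `b` ⇐ multiplicativity of `ϖ_{1j}`.**
[cite: Zhang2022LandauSiegel, §15 (15.20) p. 86] -/
theorem eq15_20_lit_of_varpiMult (hm : Inline15_varpiMult c') : Eq15_20 c' bLit :=
  eq15_20_of_varpiMult c' bLit bLit_eq_zero_of_bigP_le hm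

/-- **(15.20) for the χ-absorbed coefficients `χ·b` ⇐ multiplicativity of `ϖ_{1j}`.**
[cite: Zhang2022LandauSiegel, §15 (15.20) p. 86] -/
theorem eq15_20_chi_of_varpiMult (hm : Inline15_varpiMult c') : Eq15_20 c' bChi :=
  eq15_20_of_varpiMult c' bChi bChi_eq_zero_of_bigP_le hm

end Eq1520

section Eq1518

variable (c' : ℝ)

/-- **(15.18) forces `ℳ₁(1,1;s) ≠ 0` on `σ > 9/10`** (for all large `D`, under (A)): at `d = l = 1`
the right side of (15.18) is the empty product `1`, while with `ℳ₁(1,1;s) = 0` the left side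
`ℳ₁(1,1;s)/ℳ₁(1,1;s)` would be `0` (Lean's `0/0 = 0`). [cite: Zhang2022LandauSiegel, §15 (15.18) p. 85] -/
theorem calM1_one_one_ne_zero_of_eq15_18 (h18 : Eq15_18 c') :
    Skeleton.ForAllLarge fun D _ χ => Skeleton.AssumptionA D χ →
      ∀ s : ℂ, 9 / 10 < s.re → calM1 c' χ 1 1 s ≠ 0 := by
  refine h18.mono fun D _ χ _ _ h hA s hs hz => ?_
  have h1 := h hA 1 1 le_rfl le_rfl s hs
  rw [hz, zero_div, mul_one, Nat.primeFactors_one, Finset.prod_empty] at h1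
  exact zero_ne_one h1

/-- **(15.19) ⇐ (15.18)** (edge): the non-vanishing of `ℳ₁(1,1;1−β_j)` supplied by (15.18)
(`Re(1−β_j) = 1 > 9/10`) feeds `eq15_19_of_ne_zero`. [cite: Zhang2022LandauSiegel, §15 (15.19) p. 85] -/
theorem eq15_19_of_eq15_18 (b : CoefFam) (h18 : Eq15_18 c') : Eq15_19 c' b := by
  refine eq15_19_of_ne_zero c' b
    ((calM1_one_one_ne_zero_of_eq15_18 c' h18).mono fun D _ χ _ _ h hA j _ => ?_)
  refine h hA _ ?_
  simp only [Complex.sub_re, Complex.one_re, betaJ_re]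
  norm_num

/-! ### Locality of the Euler factors: dependence on `(d,l)` only through `q ∣ d`, `q ∣ l` -/

/-- `λ̃₁(q, dd′) = λ̃₁(q, d)` for a prime `q ∤ d′`. [cite: Zhang2022LandauSiegel, §15 p. 85] -/
theorem lamTilde1_prime_mul_eq {D : ℕ} (χ : DirichletCharacter ℂ D) {q : ℕ} (hq : q.Prime)
    (d : ℕ) {d' : ℕ} (hd' : Nat.Coprime q d') :
    lamTilde1 c' χ q (d * d') = lamTilde1 c' χ q d := by
  unfold lamTilde1
  rw [hq.primeFactors, Finset.filter_singleton, Finset.filter_singleton]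
  by_cases h : Nat.Coprime q d
  · rw [if_pos (Nat.Coprime.mul_right h hd'), if_pos h]
  · rw [if_neg (fun h2 => h (Nat.Coprime.coprime_mul_right_right h2)), if_neg h]

/-- `ξ₁(qʳ; dd′, ll′) = ξ₁(qʳ; d, l)` for a prime `q` with `(q, d′l′) = 1` (every divisor of `qʳ` and
every `h ∈ 𝒩(qʳ/k)` is a power of `q`). [cite: Zhang2022LandauSiegel, §15 p. 85] -/
theorem xi1_primePow_mul_eq {D : ℕ} (χ : DirichletCharacter ℂ D) {q : ℕ} (hq : q.Prime)
    (r d l : ℕ) {d' l' : ℕ} (hd' : Nat.Coprime q d') (hl' : Nat.Coprime q l') :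
    xi1 c' χ (q ^ r) (d * d') (l * l') = xi1 c' χ (q ^ r) d l := by
  unfold xi1
  have hfilt : (q ^ r).divisors.filter (fun k => Nat.Coprime k (l * l')) =
      (q ^ r).divisors.filter (fun k => Nat.Coprime k l) := by
    refine Finset.filter_congr fun k hk => ?_
    have hkl' : Nat.Coprime k l' :=
      Nat.Coprime.coprime_dvd_left (Nat.dvd_of_mem_divisors hk) (Nat.Coprime.pow_left r hl')
    rw [Nat.coprime_mul_iff_right]
    exact ⟨fun h => h.1, fun h => ⟨h, hkl'⟩⟩
  rw [hfilt]
  refine Finset.sum_congr rfl fun k hk => ?_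
  have hk' : k ∣ q ^ r := Nat.dvd_of_mem_divisors (Finset.mem_filter.mp hk).1
  congr 1
  unfold kappaTilde1
  refine tsum_congr fun h => ?_
  have hhd' : h ∈ Skeleton.nset (q ^ r / k) → Nat.Coprime h d' := fun hn => by
    refine Nat.coprime_of_dvd fun p hp hph hpd => ?_
    have hpq : p ∣ q ^ r := dvd_trans (hn.2 p hp hph) (Nat.div_dvd_of_dvd hk')
    have hpq' : p = q := (Nat.prime_dvd_prime_iff_eq hp hq).mp (hp.dvd_of_dvd_pow hpq)
    subst hpq'
    exact (Nat.Prime.coprime_iff_not_dvd hp).mp hd' hpd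
  have hiff : (h ∈ Skeleton.nset (q ^ r / k) ∧ Nat.Coprime h (d * d' * k)) ↔
      (h ∈ Skeleton.nset (q ^ r / k) ∧ Nat.Coprime h (d * k)) := by
    simp only [Nat.coprime_mul_iff_right]
    constructor
    · rintro ⟨hn, ⟨hd, -⟩, hk⟩
      exact ⟨hn, hd, hk⟩
    · rintro ⟨hn, hd, hk⟩
      exact ⟨hn, ⟨hd, hhd' hn⟩, hk⟩
  by_cases h1 : h ∈ Skeleton.nset (q ^ r / k) ∧ Nat.Coprime h (d * d' * k)
  · rw [if_pos h1, if_pos (hiff.mp h1)]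
  · rw [if_neg h1, if_neg (fun h2 => h1 (hiff.mpr h2))]

/-- `Σ_r ξ₁(qʳ;dd′,ll′)q^{−rs} = Σ_r ξ₁(qʳ;d,l)q^{−rs}` for `(q, d′l′) = 1`.
[cite: Zhang2022LandauSiegel, §15 p. 85] -/
theorem xi1LocalSeries_mul_eq {D : ℕ} (χ : DirichletCharacter ℂ D) {q : ℕ} (hq : q.Prime)
    (d l : ℕ) {d' l' : ℕ} (hd' : Nat.Coprime q d') (hl' : Nat.Coprime q l') (s : ℂ) :
    xi1LocalSeries c' χ q (d * d') (l * l') s = xi1LocalSeries c' χ q d l s := by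
  unfold xi1LocalSeries
  refine tsum_congr fun r => ?_
  rw [xi1_primePow_mul_eq c' χ hq r d l hd' hl']

/-- The local factor of (15.18) at `q` is unchanged when `(d,l)` is multiplied by a pair `(d′,l′)`
coprime to `q`. [cite: Zhang2022LandauSiegel, §15 (15.18) p. 85] -/
theorem localRatio_mul_eq {D : ℕ} (χ : DirichletCharacter ℂ D) {q : ℕ} (hq : q.Prime)
    (d l : ℕ) {d' l' : ℕ} (hd' : Nat.Coprime q d') (hl' : Nat.Coprime q l') (s : ℂ) :
    (1 + lamTilde1 c' χ q (d * d') * xi1LocalSeries c' χ q (d * d') (l * l') s) *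
        (1 + lamTilde1 c' χ q 1 * xi1LocalSeries c' χ q 1 1 s)⁻¹ =
      (1 + lamTilde1 c' χ q d * xi1LocalSeries c' χ q d l s) *
        (1 + lamTilde1 c' χ q 1 * xi1LocalSeries c' χ q 1 1 s)⁻¹ := by
  rw [lamTilde1_prime_mul_eq c' χ hq d hd', xi1LocalSeries_mul_eq c' χ hq d l hd' hl' s]

/-- The right side of (15.18) splits over coprime pairs: for `(d₁l₁, d₂l₂) = 1`,
`∏_{q∣d₁d₂l₁l₂} ρ_q(d₁d₂,l₁l₂) = ∏_{q∣d₁l₁} ρ_q(d₁,l₁) · ∏_{q∣d₂l₂} ρ_q(d₂,l₂)`.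
[cite: Zhang2022LandauSiegel, §15 (15.18) p. 85] -/
theorem prod_localRatio_mul {D : ℕ} (χ : DirichletCharacter ℂ D) (s : ℂ) {d₁ l₁ d₂ l₂ : ℕ}
    (hcop : Nat.Coprime (d₁ * l₁) (d₂ * l₂)) :
    ∏ q ∈ (d₁ * d₂ * (l₁ * l₂)).primeFactors,
        (1 + lamTilde1 c' χ q (d₁ * d₂) * xi1LocalSeries c' χ q (d₁ * d₂) (l₁ * l₂) s) *
          (1 + lamTilde1 c' χ q 1 * xi1LocalSeries c' χ q 1 1 s)⁻¹ =
      (∏ q ∈ (d₁ * l₁).primeFactors,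
          (1 + lamTilde1 c' χ q d₁ * xi1LocalSeries c' χ q d₁ l₁ s) *
            (1 + lamTilde1 c' χ q 1 * xi1LocalSeries c' χ q 1 1 s)⁻¹) *
        ∏ q ∈ (d₂ * l₂).primeFactors,
          (1 + lamTilde1 c' χ q d₂ * xi1LocalSeries c' χ q d₂ l₂ s) *
            (1 + lamTilde1 c' χ q 1 * xi1LocalSeries c' χ q 1 1 s)⁻¹ := by
  have e : d₁ * d₂ * (l₁ * l₂) = (d₁ * l₁) * (d₂ * l₂) := by ring
  rw [e, Nat.Coprime.primeFactors_mul hcop, Finset.prod_union hcop.disjoint_primeFactors]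
  congr 1
  · refine Finset.prod_congr rfl fun q hq => ?_
    have hqp := Nat.prime_of_mem_primeFactors hq
    have hc2 : Nat.Coprime q (d₂ * l₂) :=
      Nat.Coprime.coprime_dvd_left (Nat.dvd_of_mem_primeFactors hq) hcop
    exact localRatio_mul_eq c' χ hqp d₁ l₁ (Nat.Coprime.coprime_mul_right_right hc2)
      (Nat.Coprime.coprime_mul_left_right hc2) s
  · refine Finset.prod_congr rfl fun q hq => ?_
    have hqp := Nat.prime_of_mem_primeFactors hq
    have hc1 : Nat.Coprime q (d₁ * l₁) :=
      Nat.Coprime.coprime_dvd_left (Nat.dvd_of_mem_primeFactors hq) hcop.symm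
    rw [mul_comm d₁ d₂, mul_comm l₁ l₂]
    exact localRatio_mul_eq c' χ hqp d₂ l₂ (Nat.Coprime.coprime_mul_right_right hc1)
      (Nat.Coprime.coprime_mul_left_right hc1) s

/-- `λ₁(mn,s) = λ₁(m,s)λ₁(n,s)` for `(m,n) = 1` (a product over the prime factors).
[cite: Zhang2022LandauSiegel, §15 (15.10) p. 82] -/
theorem lam1_mul_of_coprime {D : ℕ} (χ : DirichletCharacter ℂ D) {m n : ℕ} (hmn : Nat.Coprime m n)
    (s : ℂ) : lam1 c' χ (m * n) s = lam1 c' χ m s * lam1 c' χ n s := by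
  unfold lam1
  rw [Nat.Coprime.primeFactors_mul hmn, Finset.prod_union hmn.disjoint_primeFactors]

/-- The divisor pairs of `mn`, `(m,n) = 1`, are the products of the divisor pairs of `m` and of `n`
(the bijection `((i,j),(k,l)) ↦ (ik, jl)`; the same statement is proved, for other purposes, as
`…EllipticCurves.ModularForms.UpperHecke.sum_divisorsAntidiagonal_mul_of_coprime` and privately in
`TypedSection16B` — re-proved here privately so that the §15 import cone stays minimal). [folklore] -/
private theorem sum_divisorsAntidiagonal_mul_of_coprime {M : Type*} [AddCommMonoid M] {m n : ℕ}
    (hmn : m.Coprime n) (f : ℕ × ℕ → M) :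
    ∑ w ∈ (m * n).divisorsAntidiagonal, f w =
      ∑ x ∈ m.divisorsAntidiagonal, ∑ y ∈ n.divisorsAntidiagonal, f (x.1 * y.1, x.2 * y.2) := by
  rw [← Finset.sum_product']
  symm
  apply Finset.sum_nbij fun ((i, j), k, l) ↦ (i * k, j * l)
  · rintro ⟨⟨a1, a2⟩, ⟨b1, b2⟩⟩ h
    simp only [Nat.mem_divisorsAntidiagonal, Ne, Finset.mem_product] at h
    rcases h with ⟨⟨rfl, ha⟩, ⟨rfl, hb⟩⟩
    simp only [Nat.mem_divisorsAntidiagonal, mul_eq_zero, Ne]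
    constructor
    · ring
    rw [mul_eq_zero] at *
    exact not_or_intro ha hb
  · simp only [Set.InjOn, Finset.mem_coe, Nat.mem_divisorsAntidiagonal, Finset.mem_product, Prod.mk_inj]
    rintro ⟨⟨a1, a2⟩, ⟨b1, b2⟩⟩ ⟨⟨rfl, ha⟩, ⟨rfl, hb⟩⟩ ⟨⟨c1, c2⟩, ⟨d1, d2⟩⟩ hcd h
    have cop := hmn
    ext
    · trans Nat.gcd (a1 * a2) (a1 * b1)
      · rw [Nat.gcd_mul_left, cop.coprime_mul_left.coprime_mul_right_right.gcd_eq_one, mul_one]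
      · rw [← hcd.1.1, ← hcd.2.1] at cop
        rw [← hcd.1.1, h.1, Nat.gcd_mul_left,
          cop.coprime_mul_left.coprime_mul_right_right.gcd_eq_one, mul_one]
    · trans Nat.gcd (a1 * a2) (a2 * b2)
      · rw [mul_comm, Nat.gcd_mul_left, cop.coprime_mul_right.coprime_mul_left_right.gcd_eq_one,
          mul_one]
      · rw [← hcd.1.1, ← hcd.2.1] at cop
        rw [← hcd.1.1, h.2, mul_comm, Nat.gcd_mul_left,
          cop.coprime_mul_right.coprime_mul_left_right.gcd_eq_one, mul_one]
    · trans Nat.gcd (b1 * b2) (a1 * b1)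
      · rw [mul_comm, Nat.gcd_mul_right,
          cop.coprime_mul_right.coprime_mul_left_right.symm.gcd_eq_one, one_mul]
      · rw [← hcd.1.1, ← hcd.2.1] at cop
        rw [← hcd.2.1, h.1, mul_comm c1 d1, Nat.gcd_mul_left,
          cop.coprime_mul_right.coprime_mul_left_right.symm.gcd_eq_one, mul_one]
    · trans Nat.gcd (b1 * b2) (a2 * b2)
      · rw [Nat.gcd_mul_right, cop.coprime_mul_left.coprime_mul_right_right.symm.gcd_eq_one, one_mul]
      · rw [← hcd.1.1, ← hcd.2.1] at cop
        rw [← hcd.2.1, h.2, Nat.gcd_mul_right,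
          cop.coprime_mul_left.coprime_mul_right_right.symm.gcd_eq_one, one_mul]
  · simp only [Set.SurjOn, Set.subset_def, Finset.mem_coe, Nat.mem_divisorsAntidiagonal,
      Finset.mem_product, Set.mem_image]
    rintro ⟨b1, b2⟩ h
    use ((b1.gcd m, b2.gcd m), (b1.gcd n, b2.gcd n))
    rw [← hmn.gcd_mul _, ← hmn.gcd_mul _, ← h.1, Nat.gcd_mul_gcd_of_coprime_of_mul_eq_mul hmn h.1,
      Nat.gcd_mul_gcd_of_coprime_of_mul_eq_mul hmn.symm _]
    · rw [Ne, mul_eq_zero, not_or] at h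
      simp [h.2.1, h.2.2]
    rw [mul_comm n m, h.1]
  · rintro ⟨⟨a1, a2⟩, ⟨b1, b2⟩⟩ _
    rfl

/-- **"In view of (15.18), we see that `ϖ_{1j}(n)` is a multiplicative function" — the inline claim
of p. 85 ⇐ (15.18)** (edge). By (15.18) the summand of `ϖ_{1j}(n) = Σ_{n=dl} λ₁(d)d^{β_j}χ(l)
ℳ₁(d,l;1−β_j)/ℳ₁(1,1;1−β_j)` is `λ₁(d)d^{β_j}χ(l)∏_{q∣dl}ρ_q(d,l)` with local factors `ρ_q` depending
on `(d,l)` only through `q ∣ d`, `q ∣ l` (`localRatio_mul_eq`), hence is multiplicative in the pair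
`(d,l)` over coprime supports (`prod_localRatio_mul`, `lam1_mul_of_coprime`); summing over the divisor
pairs of a coprime product `mn` (`sum_divisorsAntidiagonal_mul_of_coprime`) gives
`ϖ_{1j}(mn) = ϖ_{1j}(m)ϖ_{1j}(n)`, and `ϖ_{1j}(1) = 1` because (15.18) forces `ℳ₁(1,1;1−β_j) ≠ 0`.
[cite: Zhang2022LandauSiegel, §15 p. 85] -/
theorem inline15_varpiMult_of_eq15_18 (h18 : Eq15_18 c') : Inline15_varpiMult c' := by
  have hne := calM1_one_one_ne_zero_of_eq15_18 c' h18
  refine (h18.and hne).mono fun D _ χ _ _ h hA j _ => ?_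
  obtain ⟨h18D, hneD⟩ := h
  have hsre : 9 / 10 < (1 - Skeleton.betaJ c' D j).re := by
    simp only [Complex.sub_re, Complex.one_re, betaJ_re]
    norm_num
  have hM0 : calM1 c' χ 1 1 (1 - Skeleton.betaJ c' D j) ≠ 0 := hneD hA _ hsre
  have hrat := fun d l (hd : 1 ≤ d) (hl : 1 ≤ l) => h18D hA d l hd hl _ hsre
  constructor
  · unfold varpi1
    rw [Nat.divisorsAntidiagonal_one, Finset.sum_singleton, div_self hM0]
    unfold lam1
    simp
  · intro m n hmn
    rcases Nat.eq_zero_or_pos m with hm0 | hm0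
    · subst hm0
      simp [varpi1]
    rcases Nat.eq_zero_or_pos n with hn0 | hn0
    · subst hn0
      simp [varpi1]
    unfold varpi1
    rw [sum_divisorsAntidiagonal_mul_of_coprime hmn, Finset.sum_mul_sum]
    refine Finset.sum_congr rfl fun x hx => Finset.sum_congr rfl fun y hy => ?_
    have hx' := Nat.mem_divisorsAntidiagonal.mp hx
    have hy' := Nat.mem_divisorsAntidiagonal.mp hy
    have hx1 : 1 ≤ x.1 := Nat.pos_of_ne_zero fun h0 => hx'.2 (by rw [← hx'.1, h0, zero_mul])
    have hx2 : 1 ≤ x.2 := Nat.pos_of_ne_zero fun h0 => hx'.2 (by rw [← hx'.1, h0, mul_zero])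
    have hy1 : 1 ≤ y.1 := Nat.pos_of_ne_zero fun h0 => hy'.2 (by rw [← hy'.1, h0, zero_mul])
    have hy2 : 1 ≤ y.2 := Nat.pos_of_ne_zero fun h0 => hy'.2 (by rw [← hy'.1, h0, mul_zero])
    have hcop : Nat.Coprime (x.1 * x.2) (y.1 * y.2) := by rw [hx'.1, hy'.1]; exact hmn
    have hcop1 : Nat.Coprime x.1 y.1 :=
      Nat.Coprime.coprime_dvd_left (Dvd.intro _ rfl)
        (Nat.Coprime.coprime_dvd_right (Dvd.intro _ rfl) hcop)
    simp only
    rw [div_eq_mul_inv, div_eq_mul_inv, div_eq_mul_inv]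
    rw [← div_eq_mul_inv (calM1 c' χ (x.1 * y.1) (x.2 * y.2) _),
      ← div_eq_mul_inv (calM1 c' χ x.1 x.2 _), ← div_eq_mul_inv (calM1 c' χ y.1 y.2 _),
      hrat _ _ (Nat.one_le_iff_ne_zero.mpr (Nat.mul_ne_zero (by omega) (by omega)))
        (Nat.one_le_iff_ne_zero.mpr (Nat.mul_ne_zero (by omega) (by omega))),
      hrat x.1 x.2 hx1 hx2, hrat y.1 y.2 hy1 hy2, prod_localRatio_mul c' χ _ hcop,
      lam1_mul_of_coprime c' χ hcop1]
    push_cast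
    rw [Complex.natCast_mul_natCast_cpow, map_mul]
    ring

/-- **(15.20) for the printed `b` ⇐ (15.18)** (chaining `inline15_varpiMult_of_eq15_18` and
`eq15_20_lit_of_varpiMult`). [cite: Zhang2022LandauSiegel, §15 (15.20) p. 86] -/
theorem eq15_20_lit_of_eq15_18 (h18 : Eq15_18 c') : Eq15_20 c' bLit :=
  eq15_20_lit_of_varpiMult c' (inline15_varpiMult_of_eq15_18 c' h18)

/-- **(15.20) for `χ·b` ⇐ (15.18)**. [cite: Zhang2022LandauSiegel, §15 (15.20) p. 86] -/
theorem eq15_20_chi_of_eq15_18 (h18 : Eq15_18 c') : Eq15_20 c' bChi :=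
  eq15_20_chi_of_varpiMult c' (inline15_varpiMult_of_eq15_18 c' h18)

end Eq1518

/-! ## Kernel discharge of the inline claim of p. 83: `ξ₁(n;d,l)` is multiplicative in `n` -/

section Xi1Mult

variable (c' : ℝ)

/-- **`|κ₁(n)| ≤ τ₂(n)²`** (from `|κ₁(pᵏ)| ≤ (k+1)²` and multiplicativity).
[cite: Zhang2022LandauSiegel, §15 p. 82] -/
theorem norm_kappa1_le_sq (D : ℕ) {n : ℕ} (hn : n ≠ 0) :
    ‖kappa1 c' D n‖ ≤ (n.divisors.card : ℝ) ^ 2 := by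
  induction n using Nat.recOnPosPrimePosCoprime with
  | prime_pow p k hp hk =>
    rw [Nat.divisors_prime_pow hp, Finset.card_map, Finset.card_range]
    push_cast
    exact MeanSquareMajorant.norm_kappa₁_prime_pow_le _ _ hp k
  | zero => exact absurd rfl hn
  | one =>
    have : kappa1 c' D 1 = 1 := (MeanSquareMajorant.isMultiplicative_kappa₁ _ _).map_one
    rw [this]
    simp
  | coprime a b ha hb hab iha ihb =>
    have e : kappa1 c' D (a * b) = kappa1 c' D a * kappa1 c' D b :=
      (MeanSquareMajorant.isMultiplicative_kappa₁ _ _).map_mul_of_coprime hab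
    rw [e, norm_mul, Nat.Coprime.card_divisors_mul hab, Nat.cast_mul, mul_pow]
    exact mul_le_mul (iha (by omega)) (ihb (by omega)) (norm_nonneg _) (sq_nonneg _)

/-- `𝒩(m)` is Mathlib's set of `m.primeFactors`-factored numbers (`m ≠ 0`).
[cite: Zhang2022LandauSiegel, §7 p. 13] -/
theorem mem_nset_iff_mem_factoredNumbers {m : ℕ} (hm : m ≠ 0) (h : ℕ) :
    h ∈ Skeleton.nset m ↔ h ∈ Nat.factoredNumbers m.primeFactors := by
  simp only [Skeleton.nset, Set.mem_setOf_eq, Nat.mem_factoredNumbers]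
  constructor
  · rintro ⟨h0, hq⟩
    refine ⟨h0.ne', fun p hp => ?_⟩
    rw [Nat.mem_primeFactorsList h0.ne'] at hp
    exact Nat.mem_primeFactors.mpr ⟨hp.1, hq p hp.1 hp.2, hm⟩
  · rintro ⟨h0, hq⟩
    refine ⟨Nat.pos_of_ne_zero h0, fun q hq' hqh => ?_⟩
    have := hq q ((Nat.mem_primeFactorsList h0).mpr ⟨hq', hqh⟩)
    exact (Nat.mem_primeFactors.mp this).2.1

/-- The majorant `τ₂(h)²/h` is summable over the `S`-factored numbers, for every finite set of
primes `S` (a finite Euler product of the convergent local series `Σ_i (i+1)²p^{−i}`).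
[cite: Zhang2022LandauSiegel, §15 p. 82] -/
theorem summable_factoredNumbers_sq_div (S : Finset ℕ) :
    Summable (fun h : Nat.factoredNumbers S => ‖((h : ℕ).divisors.card : ℝ) ^ 2 / ((h : ℕ) : ℝ)‖) := by
  have h1 : (((1 : ℕ).divisors.card : ℝ)) ^ 2 / ((1 : ℕ) : ℝ) = 1 := by
    rw [Nat.divisors_one, Finset.card_singleton]; norm_num
  have hmul : ∀ {m n : ℕ}, Nat.Coprime m n →
      (((m * n).divisors.card : ℝ)) ^ 2 / ((m * n : ℕ) : ℝ) =
        (((m.divisors.card : ℝ)) ^ 2 / (m : ℝ)) * (((n.divisors.card : ℝ)) ^ 2 / (n : ℝ)) := by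
    intro m n hmn
    rw [Nat.Coprime.card_divisors_mul hmn, Nat.cast_mul, Nat.cast_mul, mul_pow,
      div_mul_div_comm]
  have hloc : ∀ {p : ℕ}, p.Prime → ∀ i : ℕ,
      ‖(((p ^ i).divisors.card : ℝ)) ^ 2 / ((p ^ i : ℕ) : ℝ)‖ ≤ ((i : ℝ) + (1 : ℕ)) ^ 2 * (1 / 2 : ℝ) ^ i := by
    intro p hp i
    have hp2 : (2 : ℝ) ≤ p := by exact_mod_cast hp.two_le
    have hp0 : (0 : ℝ) < p := by linarith
    rw [Nat.divisors_prime_pow hp, Finset.card_map, Finset.card_range, Nat.cast_pow,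
      Real.norm_eq_abs, abs_of_nonneg (by positivity), div_eq_mul_inv, ← inv_pow]
    push_cast
    gcongr
    · rw [one_div]
      exact inv_anti₀ (by norm_num) hp2
  have hsum : ∀ {p : ℕ}, p.Prime →
      Summable (fun i : ℕ => ‖(((p ^ i).divisors.card : ℝ)) ^ 2 / ((p ^ i : ℕ) : ℝ)‖) :=
    fun hp => Summable.of_nonneg_of_le (fun i => norm_nonneg _) (hloc hp)
      (summable_sq_shift_geometric 1)
  exact (EulerProduct.summable_and_hasSum_factoredNumbers_prod_filter_prime_tsum
    (f := fun n : ℕ => ((n.divisors.card : ℝ)) ^ 2 / (n : ℝ)) h1 hmul hsum S).1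

open scoped Classical in
/-- **The series `κ̃₁(m;r) = Σ_{h∈𝒩(m),(h,r)=1} κ₁(mh)χ(h)h⁻¹` converges absolutely** (`m ≥ 1`):
`|κ₁(mh)| ≤ τ₂(m)²τ₂(h)²` and `Σ_{h∈𝒩(m)} τ₂(h)²/h < ∞`. [cite: Zhang2022LandauSiegel, §15 (15.9) p. 82] -/
theorem summable_norm_kappaTilde1_term {D : ℕ} (χ : DirichletCharacter ℂ D) {m : ℕ} (hm : m ≠ 0)
    (r : ℕ) :
    Summable (fun h : ℕ => ‖(if h ∈ Skeleton.nset m ∧ Nat.Coprime h r then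
      kappa1 c' D (m * h) * χ (h : ZMod D) / (h : ℂ) ^ (1 : ℂ) else 0 : ℂ)‖) := by
  set S := m.primeFactors with hS
  have hg : Summable ((Nat.factoredNumbers S).indicator
      (fun h : ℕ => (m.divisors.card : ℝ) ^ 2 * (((h.divisors.card : ℝ)) ^ 2 / (h : ℝ)))) := by
    rw [← summable_subtype_iff_indicator]
    have := (summable_factoredNumbers_sq_div S).mul_left ((m.divisors.card : ℝ) ^ 2)
    refine this.congr fun h => ?_
    simp only [Function.comp_apply, Real.norm_eq_abs]
    rw [abs_of_nonneg (by positivity)]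
  refine Summable.of_nonneg_of_le (fun h => norm_nonneg _) (fun h => ?_) hg
  by_cases hh : h ∈ Skeleton.nset m ∧ Nat.Coprime h r
  · have hhF : h ∈ Nat.factoredNumbers S := (mem_nset_iff_mem_factoredNumbers hm h).mp hh.1
    rw [if_pos hh, Set.indicator_of_mem hhF]
    have h0 : 0 < h := hh.1.1
    have hmh : m * h ≠ 0 := Nat.mul_ne_zero hm h0.ne'
    rw [norm_div, norm_mul, Complex.cpow_one, Complex.norm_natCast]
    have hχ : ‖χ (h : ZMod D)‖ ≤ 1 := DirichletCharacter.norm_le_one χ _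
    have hk : ‖kappa1 c' D (m * h)‖ ≤ (m.divisors.card : ℝ) ^ 2 * (h.divisors.card : ℝ) ^ 2 := by
      refine (norm_kappa1_le_sq c' D hmh).trans ?_
      rw [← mul_pow]
      gcongr
      -- `τ₂(mh) ≤ τ₂(m)τ₂(h)` (the tree's `DFI1995.card_divisors_mul_le`, re-derived inline)
      have hτ : (m * h).divisors.card ≤ m.divisors.card * h.divisors.card := by
        rw [Nat.divisors_mul]; exact Finset.card_mul_le
      exact_mod_cast hτ
    have hh0 : (0 : ℝ) < h := by exact_mod_cast h0
    rw [div_le_iff₀ hh0]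
    calc ‖kappa1 c' D (m * h)‖ * ‖χ (h : ZMod D)‖
        ≤ ((m.divisors.card : ℝ) ^ 2 * (h.divisors.card : ℝ) ^ 2) * 1 :=
          mul_le_mul hk hχ (norm_nonneg _) (by positivity)
      _ = (m.divisors.card : ℝ) ^ 2 * ((h.divisors.card : ℝ) ^ 2 / (h : ℝ)) * h := by
          field_simp
  · rw [if_neg hh, norm_zero]
    exact Set.indicator_nonneg (fun x _ => by positivity) _

open scoped Classical in
/-- The series `κ̃₁(m;r)` is summable (`m ≥ 1`). [cite: Zhang2022LandauSiegel, §15 (15.9) p. 82] -/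
theorem summable_kappaTilde1_term {D : ℕ} (χ : DirichletCharacter ℂ D) {m : ℕ} (hm : m ≠ 0)
    (r : ℕ) :
    Summable (fun h : ℕ => (if h ∈ Skeleton.nset m ∧ Nat.Coprime h r then
      kappa1 c' D (m * h) * χ (h : ZMod D) / (h : ℂ) ^ (1 : ℂ) else 0 : ℂ)) :=
  (summable_norm_kappaTilde1_term c' χ hm r).of_norm

/-- Numbers from `𝒩(m₁)` and `𝒩(m₂)` are coprime when `(m₁, m₂) = 1`.
[cite: Zhang2022LandauSiegel, §7 p. 13] -/
theorem coprime_of_mem_nset_of_mem_nset {m₁ m₂ a b : ℕ} (hm : Nat.Coprime m₁ m₂)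
    (ha : a ∈ Skeleton.nset m₁) (hb : b ∈ Skeleton.nset m₂) : Nat.Coprime a b := by
  apply Nat.coprime_of_dvd
  intro q hq hqa hqb
  have h1 : q ∣ m₁ := ha.2 q hq hqa
  have h2 : q ∣ m₂ := hb.2 q hq hqb
  have := Nat.dvd_gcd h1 h2
  rw [hm] at this
  exact hq.one_lt.ne' (Nat.dvd_one.mp this)

/-- `m ∈ 𝒩(m)` for `m ≥ 1`. [cite: Zhang2022LandauSiegel, §7 p. 13] -/
theorem self_mem_nset {m : ℕ} (hm : m ≠ 0) : m ∈ Skeleton.nset m :=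
  ⟨Nat.pos_of_ne_zero hm, fun _ _ h => h⟩

/-- `𝒩` is multiplicative: `a ∈ 𝒩(m₁)`, `b ∈ 𝒩(m₂)` ⇒ `ab ∈ 𝒩(m₁m₂)`.
[cite: Zhang2022LandauSiegel, §7 p. 13] -/
theorem mul_mem_nset_mul {m₁ m₂ a b : ℕ} (ha : a ∈ Skeleton.nset m₁) (hb : b ∈ Skeleton.nset m₂) :
    a * b ∈ Skeleton.nset (m₁ * m₂) := by
  refine ⟨Nat.mul_pos ha.1 hb.1, fun q hq hqab => ?_⟩
  rcases (Nat.Prime.dvd_mul hq).mp hqab with h | h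
  · exact dvd_mul_of_dvd_left (ha.2 q hq h) _
  · exact dvd_mul_of_dvd_right (hb.2 q hq h) _

/-- `𝒩(m) · a ⊆ 𝒩(m)`-type closure: `m·a ∈ 𝒩(m)` for `a ∈ 𝒩(m)`, `m ≥ 1`.
[cite: Zhang2022LandauSiegel, §7 p. 13] -/
theorem self_mul_mem_nset {m a : ℕ} (hm : m ≠ 0) (ha : a ∈ Skeleton.nset m) :
    m * a ∈ Skeleton.nset m := by
  have := mul_mem_nset_mul (self_mem_nset hm) ha
  refine ⟨this.1, fun q hq hqd => ?_⟩
  have h := this.2 q hq hqd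
  rcases (Nat.Prime.dvd_mul hq).mp h with h' | h'
  · exact h'
  · exact h'

/-- Every `h ∈ 𝒩(m₁m₂)` factors as `h = ab` with `a ∈ 𝒩(m₁)`, `b ∈ 𝒩(m₂)` (`m₁ ≥ 1`).
[cite: Zhang2022LandauSiegel, §7 p. 13] -/
theorem exists_mem_nset_mul_of_mem_nset_mul {m₁ m₂ h : ℕ} (hh : h ∈ Skeleton.nset (m₁ * m₂)) :
    ∃ a b : ℕ, a * b = h ∧ a ∈ Skeleton.nset m₁ ∧ b ∈ Skeleton.nset m₂ := by
  classical
  have h0 : h ≠ 0 := hh.1.ne'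
  refine ⟨∏ p ∈ h.primeFactors.filter (fun p => p ∣ m₁), p ^ h.factorization p,
    ∏ p ∈ h.primeFactors.filter (fun p => ¬ p ∣ m₁), p ^ h.factorization p, ?_, ?_, ?_⟩
  · rw [Finset.prod_filter_mul_prod_filter_not]
    conv_rhs => rw [← Nat.prod_factorization_pow_eq_self h0]
    rw [Nat.prod_factorization_eq_prod_primeFactors]
  · refine ⟨Finset.prod_pos fun p hp => pow_pos (Nat.prime_of_mem_primeFactors
      (Finset.mem_filter.mp hp).1).pos _, fun q hq hqd => ?_⟩
    rw [(Nat.Prime.prime hq).dvd_finsetProd_iff] at hqd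
    obtain ⟨p, hp, hqp⟩ := hqd
    rw [Finset.mem_filter] at hp
    have hpp : p.Prime := Nat.prime_of_mem_primeFactors hp.1
    rw [(Nat.prime_dvd_prime_iff_eq hq hpp).mp (hq.dvd_of_dvd_pow hqp)]
    exact hp.2
  · refine ⟨Finset.prod_pos fun p hp => pow_pos (Nat.prime_of_mem_primeFactors
      (Finset.mem_filter.mp hp).1).pos _, fun q hq hqd => ?_⟩
    rw [(Nat.Prime.prime hq).dvd_finsetProd_iff] at hqd
    obtain ⟨p, hp, hqp⟩ := hqd
    rw [Finset.mem_filter] at hp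
    have hpp : p.Prime := Nat.prime_of_mem_primeFactors hp.1
    have hqp' : q = p := (Nat.prime_dvd_prime_iff_eq hq hpp).mp (hq.dvd_of_dvd_pow hqp)
    subst hqp'
    have hqh : q ∣ h := Nat.dvd_of_mem_primeFactors hp.1
    rcases (Nat.Prime.dvd_mul hq).mp (hh.2 q hq hqh) with h1 | h2
    · exact absurd h1 hp.2
    · exact h2

open scoped Classical in
/-- The summand of `κ̃₁(m₁m₂;r)` at `h = ab` (`a ∈ 𝒩(m₁)`, `b ∈ 𝒩(m₂)`, `(m₁,m₂) = 1`) is the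
product of the summands of `κ̃₁(m₁;r)` at `a` and of `κ̃₁(m₂;r)` at `b` (`κ₁` multiplicative).
[cite: Zhang2022LandauSiegel, §15 (15.9) p. 82] -/
theorem kappaTilde1_term_mul {D : ℕ} (χ : DirichletCharacter ℂ D) {m₁ m₂ : ℕ} (hm₁ : m₁ ≠ 0)
    (hm₂ : m₂ ≠ 0) (hm : Nat.Coprime m₁ m₂) (r : ℕ) {a b : ℕ} (ha : a ∈ Skeleton.nset m₁)
    (hb : b ∈ Skeleton.nset m₂) :
    (if a * b ∈ Skeleton.nset (m₁ * m₂) ∧ Nat.Coprime (a * b) r then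
        kappa1 c' D (m₁ * m₂ * (a * b)) * χ ((a * b : ℕ) : ZMod D) / ((a * b : ℕ) : ℂ) ^ (1 : ℂ)
        else 0) =
      (if a ∈ Skeleton.nset m₁ ∧ Nat.Coprime a r then
          kappa1 c' D (m₁ * a) * χ (a : ZMod D) / (a : ℂ) ^ (1 : ℂ) else 0) *
        (if b ∈ Skeleton.nset m₂ ∧ Nat.Coprime b r then
          kappa1 c' D (m₂ * b) * χ (b : ZMod D) / (b : ℂ) ^ (1 : ℂ) else 0) := by
  have hab : a * b ∈ Skeleton.nset (m₁ * m₂) := mul_mem_nset_mul ha hb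
  by_cases hca : Nat.Coprime a r
  · by_cases hcb : Nat.Coprime b r
    · rw [if_pos ⟨hab, Nat.Coprime.mul_left hca hcb⟩, if_pos ⟨ha, hca⟩, if_pos ⟨hb, hcb⟩]
      have hcop : Nat.Coprime (m₁ * a) (m₂ * b) :=
        coprime_of_mem_nset_of_mem_nset hm (self_mul_mem_nset hm₁ ha) (self_mul_mem_nset hm₂ hb)
      have e : m₁ * m₂ * (a * b) = (m₁ * a) * (m₂ * b) := by ring
      have e2 : kappa1 c' D ((m₁ * a) * (m₂ * b)) = kappa1 c' D (m₁ * a) * kappa1 c' D (m₂ * b) :=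
        (MeanSquareMajorant.isMultiplicative_kappa₁ _ _).map_mul_of_coprime hcop
      rw [e, e2, Nat.cast_mul, Nat.cast_mul, map_mul χ ((a : ℕ) : ZMod D) ((b : ℕ) : ZMod D),
        Complex.cpow_one, Complex.cpow_one, Complex.cpow_one]
      have ha0 : (a : ℂ) ≠ 0 := by exact_mod_cast ha.1.ne'
      have hb0 : (b : ℂ) ≠ 0 := by exact_mod_cast hb.1.ne'
      field_simp
    · rw [if_neg (fun h => hcb (Nat.Coprime.coprime_mul_left h.2)), if_pos ⟨ha, hca⟩,
        if_neg (fun h => hcb h.2), mul_zero]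
  · rw [if_neg (fun h => hca (Nat.Coprime.coprime_mul_right h.2)), if_neg (fun h => hca h.2),
      zero_mul]

/-- **`κ̃₁(m₁m₂;r) = κ̃₁(m₁;r)κ̃₁(m₂;r)` for `(m₁,m₂) = 1`** (at `s = 1`): the map `(a,b) ↦ ab`,
`𝒩(m₁) × 𝒩(m₂) → 𝒩(m₁m₂)`, is a bijection, `κ₁` is multiplicative, and both series converge
absolutely (`summable_norm_kappaTilde1_term`). [cite: Zhang2022LandauSiegel, §15 (15.9) p. 82] -/
theorem kappaTilde1_mul_of_coprime {D : ℕ} (χ : DirichletCharacter ℂ D) {m₁ m₂ : ℕ}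
    (hm₁ : m₁ ≠ 0) (hm₂ : m₂ ≠ 0) (hm : Nat.Coprime m₁ m₂) (r : ℕ) :
    kappaTilde1 c' χ (m₁ * m₂) r 1 = kappaTilde1 c' χ m₁ r 1 * kappaTilde1 c' χ m₂ r 1 := by
  classical
  unfold kappaTilde1
  rw [tsum_mul_tsum_of_summable_norm (summable_norm_kappaTilde1_term c' χ hm₁ r)
    (summable_norm_kappaTilde1_term c' χ hm₂ r)]
  symm
  -- reindex the double series along `(a, b) ↦ ab`
  set T₁ : ℕ → ℂ := fun h => if h ∈ Skeleton.nset m₁ ∧ Nat.Coprime h r then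
      kappa1 c' D (m₁ * h) * χ (h : ZMod D) / (h : ℂ) ^ (1 : ℂ) else 0 with hT₁
  set T₂ : ℕ → ℂ := fun h => if h ∈ Skeleton.nset m₂ ∧ Nat.Coprime h r then
      kappa1 c' D (m₂ * h) * χ (h : ZMod D) / (h : ℂ) ^ (1 : ℂ) else 0 with hT₂
  set T : ℕ → ℂ := fun h => if h ∈ Skeleton.nset (m₁ * m₂) ∧ Nat.Coprime h r then
      kappa1 c' D (m₁ * m₂ * h) * χ (h : ZMod D) / (h : ℂ) ^ (1 : ℂ) else 0 with hT
  have hne₁ : ∀ {a}, T₁ a ≠ 0 → a ∈ Skeleton.nset m₁ ∧ Nat.Coprime a r := fun h => by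
    by_contra hc; exact h (by simp only [hT₁]; rw [if_neg hc])
  have hne₂ : ∀ {b}, T₂ b ≠ 0 → b ∈ Skeleton.nset m₂ ∧ Nat.Coprime b r := fun h => by
    by_contra hc; exact h (by simp only [hT₂]; rw [if_neg hc])
  have hmulT : ∀ {a b}, a ∈ Skeleton.nset m₁ → b ∈ Skeleton.nset m₂ →
      T (a * b) = T₁ a * T₂ b := by
    intro a b ha hb
    simp only [hT, hT₁, hT₂]
    have := kappaTilde1_term_mul c' χ hm₁ hm₂ hm r ha hb
    push_cast at this ⊢
    exact this
  show ∑' z : ℕ × ℕ, T₁ z.1 * T₂ z.2 = ∑' h, T h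
  symm
  refine tsum_eq_tsum_of_ne_zero_bij (fun z => z.1.1 * z.1.2) ?_ ?_ ?_
  · rintro ⟨⟨a, b⟩, hz⟩ ⟨⟨a', b'⟩, hz'⟩ he
    simp only [Function.mem_support, ne_eq, mul_eq_zero, not_or] at hz hz'
    simp only at he
    have ha := (hne₁ hz.1).1
    have hb := (hne₂ hz.2).1
    have ha' := (hne₁ hz'.1).1
    have hb' := (hne₂ hz'.2).1
    obtain ⟨h1, h2⟩ := smooth_mul_rough_unique (K := m₁) he ha
      (coprime_of_mem_nset_of_mem_nset hm.symm hb (self_mem_nset hm₁)) ha'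
      (coprime_of_mem_nset_of_mem_nset hm.symm hb' (self_mem_nset hm₁))
    subst h1; subst h2; rfl
  · intro h hh
    rw [Function.mem_support] at hh
    have hh' : h ∈ Skeleton.nset (m₁ * m₂) := by
      by_contra hc
      exact hh (by simp only [hT]; rw [if_neg (fun h2 => hc h2.1)])
    obtain ⟨a, b, rfl, ha, hb⟩ := exists_mem_nset_mul_of_mem_nset_mul hh'
    have hz : T₁ a * T₂ b ≠ 0 := by rw [← hmulT ha hb]; exact hh
    exact ⟨⟨(a, b), by simpa [Function.mem_support] using hz⟩, rfl⟩
  · rintro ⟨⟨a, b⟩, hz⟩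
    simp only [Function.mem_support, ne_eq, mul_eq_zero, not_or] at hz
    simp only
    exact hmulT (hne₁ hz.1).1 (hne₂ hz.2).1

open scoped Classical in
/-- Locality of `κ̃₁` in the coprimality slot: `κ̃₁(m; rk, s) = κ̃₁(m; r, s)` when `(m, k) = 1`
(an `h ∈ 𝒩(m)` is automatically coprime to `k`). [cite: Zhang2022LandauSiegel, §15 (15.9) p. 82] -/
theorem kappaTilde1_mul_right_eq {D : ℕ} (χ : DirichletCharacter ℂ D) {m k : ℕ}
    (hk : Nat.Coprime m k) (r : ℕ) (s : ℂ) :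
    kappaTilde1 c' χ m (r * k) s = kappaTilde1 c' χ m r s := by
  unfold kappaTilde1
  refine tsum_congr fun h => ?_
  have hiff : (h ∈ Skeleton.nset m ∧ Nat.Coprime h (r * k)) ↔
      (h ∈ Skeleton.nset m ∧ Nat.Coprime h r) := by
    constructor
    · rintro ⟨hn, hc⟩
      exact ⟨hn, Nat.Coprime.coprime_mul_right_right hc⟩
    · rintro ⟨hn, hc⟩
      refine ⟨hn, Nat.Coprime.mul_right hc ?_⟩
      have hkk : k ∈ Skeleton.nset k ∨ k = 0 := by
        rcases Nat.eq_zero_or_pos k with h0 | h0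
        · exact Or.inr h0
        · exact Or.inl (self_mem_nset h0.ne')
      rcases hkk with hkk | hk0
      · exact coprime_of_mem_nset_of_mem_nset hk hn hkk
      · subst hk0
        have : m = 1 := by simpa using hk
        subst this
        have h1 : h = 1 := eq_one_of_mem_nset_one hn
        subst h1
        exact Nat.coprime_one_left _
  by_cases h1 : h ∈ Skeleton.nset m ∧ Nat.Coprime h (r * k)
  · rw [if_pos h1, if_pos (hiff.mp h1)]
  · rw [if_neg h1, if_neg (fun h2 => h1 (hiff.mpr h2))]

open scoped Classical in
/-- `ξ₁(n;d,l)` as a sum over the divisor pairs `(k, m)` of `n`.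
[cite: Zhang2022LandauSiegel, §15 (15.13) p. 83] -/
theorem xi1_eq_sum_divisorsAntidiagonal {D : ℕ} (χ : DirichletCharacter ℂ D) (n d l : ℕ) :
    xi1 c' χ n d l = ∑ x ∈ n.divisorsAntidiagonal,
      if Nat.Coprime x.1 l then
        (ArithmeticFunction.moebius x.1 : ℂ) * χ (x.1 : ZMod D) * (x.1 : ℂ) /
            (Nat.totient x.1 : ℂ) * kappaTilde1 c' χ x.2 (d * x.1) 1
      else 0 := by
  unfold xi1
  rw [Finset.sum_filter, ← Nat.sum_divisorsAntidiagonal fun k m =>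
    if Nat.Coprime k l then
      (ArithmeticFunction.moebius k : ℂ) * χ (k : ZMod D) * (k : ℂ) / (Nat.totient k : ℂ) *
        kappaTilde1 c' χ m (d * k) 1 else 0]

/-- **The inline claim of p. 83 holds: `ξ₁(n;d,l)` is multiplicative in `n`** (tex L4168: "It can
be verified, for given `d` and `l`, that `ξ₁(n;d,l)` is a multiplicative function of `n`").
Proof: `ξ₁(n;d,l) = Σ_{n=km,(k,l)=1} μχ(k)k/φ(k)·κ̃₁(m;dk)`; for `n = n₁n₂` coprime the divisor pairs
of `n` are the products of those of `n₁`, `n₂`; `μχ(k)k/φ(k)` is multiplicative; and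
`κ̃₁(m₁m₂; dk₁k₂) = κ̃₁(m₁; dk₁)κ̃₁(m₂; dk₂)` by `kappaTilde1_mul_of_coprime` (absolute convergence,
`κ₁` multiplicative, `𝒩(m₁)𝒩(m₂) = 𝒩(m₁m₂)`) and the locality `kappaTilde1_mul_right_eq`.
[cite: Zhang2022LandauSiegel, §15 p. 83] -/
theorem inline15_xi1Mult_holds : Inline15_xi1Mult c' := by
  classical
  intro D χ d l hd _
  constructor
  · rw [xi1_eq_sum_divisorsAntidiagonal, Nat.divisorsAntidiagonal_one, Finset.sum_singleton,
      kappaTilde1_one]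
    simp
  · intro m n hmn
    rcases Nat.eq_zero_or_pos m with hm0 | hm0
    · subst hm0
      simp [xi1_eq_sum_divisorsAntidiagonal]
    rcases Nat.eq_zero_or_pos n with hn0 | hn0
    · subst hn0
      simp [xi1_eq_sum_divisorsAntidiagonal]
    rw [xi1_eq_sum_divisorsAntidiagonal, xi1_eq_sum_divisorsAntidiagonal,
      xi1_eq_sum_divisorsAntidiagonal, sum_divisorsAntidiagonal_mul_of_coprime hmn,
      Finset.sum_mul_sum]
    refine Finset.sum_congr rfl fun x hx => Finset.sum_congr rfl fun y hy => ?_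
    have hx' := Nat.mem_divisorsAntidiagonal.mp hx
    have hy' := Nat.mem_divisorsAntidiagonal.mp hy
    have hx1 : x.1 ≠ 0 := fun h0 => hx'.2 (by rw [← hx'.1, h0, zero_mul])
    have hx2 : x.2 ≠ 0 := fun h0 => hx'.2 (by rw [← hx'.1, h0, mul_zero])
    have hy1 : y.1 ≠ 0 := fun h0 => hy'.2 (by rw [← hy'.1, h0, zero_mul])
    have hy2 : y.2 ≠ 0 := fun h0 => hy'.2 (by rw [← hy'.1, h0, mul_zero])
    have hcop : Nat.Coprime (x.1 * x.2) (y.1 * y.2) := by rw [hx'.1, hy'.1]; exact hmn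
    have h11 : Nat.Coprime x.1 y.1 :=
      Nat.Coprime.coprime_dvd_left (Dvd.intro _ rfl) (Nat.Coprime.coprime_dvd_right (Dvd.intro _ rfl) hcop)
    have h22 : Nat.Coprime x.2 y.2 :=
      Nat.Coprime.coprime_dvd_left (Dvd.intro_left _ rfl)
        (Nat.Coprime.coprime_dvd_right (Dvd.intro_left _ rfl) hcop)
    have h21 : Nat.Coprime x.2 y.1 :=
      Nat.Coprime.coprime_dvd_left (Dvd.intro_left _ rfl)
        (Nat.Coprime.coprime_dvd_right (Dvd.intro _ rfl) hcop)
    have h12 : Nat.Coprime x.1 y.2 :=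
      Nat.Coprime.coprime_dvd_left (Dvd.intro _ rfl)
        (Nat.Coprime.coprime_dvd_right (Dvd.intro_left _ rfl) hcop)
    simp only
    by_cases hcx : Nat.Coprime x.1 l
    · by_cases hcy : Nat.Coprime y.1 l
      · rw [if_pos (Nat.Coprime.mul_left hcx hcy), if_pos hcx, if_pos hcy]
        -- the `κ̃₁` factor
        have hK : kappaTilde1 c' χ (x.2 * y.2) (d * (x.1 * y.1)) 1 =
            kappaTilde1 c' χ x.2 (d * x.1) 1 * kappaTilde1 c' χ y.2 (d * y.1) 1 := by
          rw [kappaTilde1_mul_of_coprime c' χ hx2 hy2 h22, ← mul_assoc,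
            kappaTilde1_mul_right_eq c' χ h21,
            show d * x.1 * y.1 = d * y.1 * x.1 by ring, kappaTilde1_mul_right_eq c' χ h12.symm]
        -- the arithmetic factor `μχ(k)k/φ(k)`
        have hμ : (ArithmeticFunction.moebius (x.1 * y.1) : ℂ) =
            (ArithmeticFunction.moebius x.1 : ℂ) * (ArithmeticFunction.moebius y.1 : ℂ) := by
          rw [ArithmeticFunction.isMultiplicative_moebius.map_mul_of_coprime h11]
          push_cast
          ring
        have hφ : (Nat.totient (x.1 * y.1) : ℂ) = (Nat.totient x.1 : ℂ) * (Nat.totient y.1 : ℂ) := by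
          rw [Nat.totient_mul h11]; push_cast; ring
        rw [hK, hμ, hφ]
        push_cast
        rw [map_mul]
        simp only [div_eq_mul_inv, mul_inv]
        ring
      · rw [if_neg (fun h => hcy (Nat.Coprime.coprime_mul_left h)), if_pos hcx, if_neg hcy, mul_zero]
    · rw [if_neg (fun h => hcx (Nat.Coprime.coprime_mul_right h)), if_neg hcx, zero_mul]

/-- `Inline15_xi1Mult` — `_holds` alias of `inline15_xi1Mult_holds` above under the fact's exact name (appended
2026-08-28, D-0026 bookkeeping: the proof term is the existing theorem of this file; no statement,
definition or attribute is edited; no new named fact; the ledger's debt table listed the fact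
unproved). [cite: Zhang2022LandauSiegel, §15 p. 83] -/
theorem _root_.Literature.NumberTheory.LFunctions.Zhang2022.Typed.Section15B.Inline15_xi1Mult_holds :
    Inline15_xi1Mult c' :=
  _root_.Literature.NumberTheory.LFunctions.Zhang2022.Typed.Section15B.inline15_xi1Mult_holds (c' := c')


end Xi1Mult

end Literature.NumberTheory.LFunctions.Zhang2022.Typed.Section15B
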